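import Literature.Computability.Cryptography.HILLGreedyLeftover
import Literature.Computability.Cryptography.IndistinguishableFarEnsemblesFunction
import HarnessLib

/-!
# HILL Lemma 6.3.2: the machine's distinguishing probability and `𝒟 ≈_c ℰ` (Håstad–Impagliazzo–Levin–Luby 1999, §6.3)

> **Lemma 6.3.2** If `A` is an adversary for distinguishing `𝒟` and `ℰ` with success probability `δₙ` then
> there is an oracle TM `M^{(A)}` that distinguishes the distributions of Lemma 6.1.1 with probability `δₙ/(16kₙ)`,
> whose running time is polynomial in the running time of `A`, `1/δ_A(n)`, and `n`. … **Corollary 6.3.3** follows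
> immediately from Lemma 6.3.2 and Lemma 6.1.1: if `f` is a one-way function then `𝒟` and `ℰ` are
> computationally indistinguishable. [HILL 1999, §6.2 p. 30, §6.3 pp. 33–37]

The last two steps of the tree's formalization of Lemma 6.3.2 / Cor. 6.3.3 for UNIFORM adversaries, on top of
`HILLGreedySelection` (the abstract stage-sum argument), `HILLGreedySamplers` / `HILLGreedyMachine` (the samplers
`𝒟`, `ℰ` and the two-phase machine `M^{(A)}` as programs) and `HILLGreedyLaws` / `HILLGreedyLeftover` (the laws of
the concrete Phase-1 data, claim (a) of the proof):

* **Part I** (proof of Lemma 6.3.2, Phase 2) — the distinguishing probability of `M^{(A)}`: planting the challenge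
  atom of `w` at position `|τ|` is fixing one more position (`samples_chal_eq`, `runs_chal_eq`), the output rule
  accepts with probability `½ + (d − e)/2` (`avg_out2`), hence `Pr[M = 1 | real] − Pr[M = 1 | ideal] = E_j[ε^{(j)}]/2`
  (`prR_sub_prI`);
* **Part II** (Lemma 6.3.2 with Lemma 6.1.1 = Cor. 6.3.3) — the contradiction assembled:
  `HILL.GH.Params.isCompIndistinguishable_DE`, for a one-way length-preserving `f` the samplers `𝒟_N`, `ℰ_N` with the
  advice `t*(N)` (HILL's `p̃ₙ`) are computationally indistinguishable.

Each part is opened by its own `/-! ## Part … -/` docstring listing its sections (`IndistinguishableFarEnsemblesFunction`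
is imported only for the arithmetic lemma `HILL.bLen_succ_le`). No new named facts.
-/

/-!
## Part I — HILL Lemma 6.3.2, Phase 2: the distinguishing probability of `M^{(A)}` (Håstad–Impagliazzo–Levin–Luby 1999, §6.3)

> Let `w = ⟨x, i⟩`, `d^{(j)}(w,r,b,y) = E[A(𝒟^{(j)}(w,r,b,y))]` and `e^{(j)}(w,r,y) = E[A(ℰ^{(j)}(w,r,y))]`. Then
> `Pr[M^{(A)}(f'(w,r),b,y) = 1] = 1/2 + (d^{(j)}(w,r,b,y) − e^{(j)}(w,r,y))/2`. Also, it follows directly from the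
> definitions that `E[d^{(j)}(w,R,x ⊙ Y,Y) − e^{(j)}(w,R,Y)] = δ₀^{(j)}(w)` and `E[d^{(j)}(w,R,β,Y) − e^{(j)}(w,R,Y)] = δ₁^{(j)}(w)`.
> … Thus the distinguishing probability of `M^{(A)}` is `E_j[ε^{(j)}]/2`. [HILL 1999, Lemma 6.3.2 (proof)]

Part I proves these three identities for the concrete machine of `HILLGreedyMachine`:

* `samples_chal_eq` / `runs_chal_eq` / `avg_dChal_real` …: **planting a real (resp. ideal) atom of `w` at position
  `|τ|` is fixing position `|τ|` to `(w, 0)` (resp. `(w, 1)`)**, on average over the atom's randomness — a window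
  substitution on the sampler's coins (`uniformAvg_window`);
* `avg_out2`: **the output rule's acceptance is `½ + (d − e)/2`** (average over `β` and the two independent runs);
* `prR_sub_prI`: hence, averaged over Phase 1 and the atoms of the Goldreich–Levin ensembles of `HILLAtoms`,
  `Pr[M = 1 | real] − Pr[M = 1 | ideal] = E_{j}[ε]/2` with the `ε` of `HILLGreedySelection`.

No new named facts.
-/

namespace Literature.Computability.Cryptography

open Finset _root_.Computability Complexity HCProd Polynomial Real

namespace HILL

open GAvg

namespace GH

namespace Params

variable {P : Params} {f : List Bool → List Bool} {A : RandAlg (List Bool) Bool}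

/-! ### Windows at an offset inside a block -/

/-- Overwriting a window at offset `o` inside block `j` does not change the other blocks. [folklore] -/
theorem blkL_owindow_ne {L o n j i : ℕ} (hon : o + n ≤ L) {r w : List Bool} (hw : w.length = n) (hr : (j + 1) * L ≤ r.length) (hij : i ≠ j) :
    Greedy.blkL L i (r.take (j * L + o) ++ w ++ r.drop (j * L + o + n)) = Greedy.blkL L i r := by
  have hlen : ((r.drop (j * L)).take o ++ w).length = o + n := by
    rw [List.length_append, List.length_take, List.length_drop, hw, min_eq_left]; rw [Nat.succ_mul] at hr; omega
  have h := blkL_window_ne (L := L) (n := o + n) (j := j) (i := i) hon hlen hr hij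
  rw [List.take_add, List.append_assoc (r.take (j * L)), Nat.add_assoc]
  exact h

/-- Overwriting a window at offset `o` inside block `j`. [folklore] -/
theorem blkL_owindow_self {L o n j : ℕ} (hon : o + n ≤ L) {r w : List Bool} (hw : w.length = n) (hr : (j + 1) * L ≤ r.length) :
    Greedy.blkL L j (r.take (j * L + o) ++ w ++ r.drop (j * L + o + n)) = (Greedy.blkL L j r).take o ++ w ++ (Greedy.blkL L j r).drop (o + n) := by
  have hlen : ((r.drop (j * L)).take o ++ w).length = o + n := by
    rw [List.length_append, List.length_take, List.length_drop, hw, min_eq_left]; rw [Nat.succ_mul] at hr; omega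
  have h := blkL_window_self (L := L) (n := o + n) (j := j) hon hlen hr
  rw [List.take_add, List.append_assoc (r.take (j * L)), Nat.add_assoc, h, Greedy.blkL, List.take_take, min_eq_left (by omega : o ≤ L)]

/-- A block inside the string has full length. [folklore] -/
theorem length_blkL_of_le {L i : ℕ} {r : List Bool} (hr : (i + 1) * L ≤ r.length) : (Greedy.blkL L i r).length = L := by
  rw [Greedy.blkL, List.length_take, List.length_drop]
  rw [Nat.succ_mul] at hr; omega

/-! ### Planting an atom is fixing the position (functional identities) -/

/-- Slices of a position block whose `r, σ` slots are overwritten. [folklore] -/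
theorem slices_chal_real {N : ℕ} {pc ρ σ : List Bool} (hpc : N ≤ pc.length) (hρ : ρ.length = rlen N) (hσ : σ.length = kL N * N) :
    pcR N (pc.take N ++ (ρ ++ σ) ++ pc.drop (N + (rlen N + kL N * N))) = ρ ∧
      pcS N (pc.take N ++ (ρ ++ σ) ++ pc.drop (N + (rlen N + kL N * N))) = σ := by
  have hT : (pc.take N).length = N := by rw [List.length_take, min_eq_left hpc]
  constructor
  · unfold pcR
    rw [List.append_assoc, List.drop_left' hT, List.append_assoc, List.take_left' hρ]
  · unfold pcS
    rw [List.append_assoc, ← List.drop_drop, List.drop_left' hT, List.append_assoc, List.drop_left' hρ, List.take_left' hσ]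

/-- Slices of a position block whose `r, σ, u` slots are overwritten. [folklore] -/
theorem slices_chal_ideal {N : ℕ} {pc ρ σ u : List Bool} (hpc : N ≤ pc.length) (hρ : ρ.length = rlen N) (hσ : σ.length = kL N * N)
    (hu : u.length = kL N) :
    pcR N (pc.take N ++ (ρ ++ σ ++ u) ++ pc.drop (N + (rlen N + kL N * N + kL N))) = ρ ∧
      pcS N (pc.take N ++ (ρ ++ σ ++ u) ++ pc.drop (N + (rlen N + kL N * N + kL N))) = σ ∧
      pcU N (pc.take N ++ (ρ ++ σ ++ u) ++ pc.drop (N + (rlen N + kL N * N + kL N))) = u := by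
  have hT : (pc.take N).length = N := by rw [List.length_take, min_eq_left hpc]
  have hρσ : (ρ ++ σ).length = rlen N + kL N * N := by rw [List.length_append, hρ, hσ]
  refine ⟨?_, ?_, ?_⟩
  · unfold pcR
    rw [List.append_assoc, List.drop_left' hT, List.append_assoc, List.append_assoc, List.take_left' hρ]
  · unfold pcS
    rw [List.append_assoc, ← List.drop_drop, List.drop_left' hT, List.append_assoc, List.append_assoc, List.drop_left' hρ, List.take_left' hσ]
  · unfold pcU
    rw [List.append_assoc, show N + rlen N + kL N * N = N + (rlen N + kL N * N) by ring, ← List.drop_drop, List.drop_left' hT,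
      List.append_assoc, List.drop_left' hρσ, List.take_left' hu]

/-- Off the planted position the challenge template and the fixed template agree. [folklore] -/
theorem posPub_chal_ne {N : ℕ} (τ : List (List Bool × Bool)) (z : List Bool) (wc : List Bool × Bool) {i : ℕ} (hi : i ≠ τ.length) (pc : List Bool) :
    posPub f N τ true z i pc = posPub f N (τ ++ [wc]) false [] i pc := by
  have hlen : (τ ++ [wc]).length = τ.length + 1 := by rw [List.length_append, List.length_singleton]
  unfold posPub
  rcases Nat.lt_or_gt_of_ne hi with h | h
  · rw [if_pos h, if_pos (show i < (τ ++ [wc]).length by rw [hlen]; omega), List.getD_append _ _ _ _ h]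
  · rw [if_neg (show ¬ i < τ.length by omega), if_neg (show ¬ (true = true ∧ i = τ.length) by omega),
      if_neg (show ¬ i < (τ ++ [wc]).length by rw [hlen]; omega), if_neg (show ¬ (false = true ∧ i = (τ ++ [wc]).length) by simp)]

/-- The block version. [folklore] -/
theorem posBlk_chal_ne {N : ℕ} (τ : List (List Bool × Bool)) (z : List Bool) (wc : List Bool × Bool) {i : ℕ} (hi : i ≠ τ.length) (pc : List Bool) :
    posBlk N τ true z i pc = posBlk N (τ ++ [wc]) false [] i pc := by
  have hlen : (τ ++ [wc]).length = τ.length + 1 := by rw [List.length_append, List.length_singleton]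
  unfold posBlk
  rcases Nat.lt_or_gt_of_ne hi with h | h
  · rw [if_pos h, if_pos (show i < (τ ++ [wc]).length by rw [hlen]; omega), List.getD_append _ _ _ _ h]
  · rw [if_neg (show ¬ i < τ.length by omega), if_neg (show ¬ (true = true ∧ i = τ.length) by omega),
      if_neg (show ¬ i < (τ ++ [wc]).length by rw [hlen]; omega), if_neg (show ¬ (false = true ∧ i = (τ ++ [wc]).length) by simp)]

/-- At the planted position: the challenge's public part. [folklore] -/
theorem posPub_chal_self {N : ℕ} (τ : List (List Bool × Bool)) (z : List Bool) (pc : List Bool) :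
    posPub f N τ true z τ.length pc = z.take (pubLen N) := by
  unfold posPub
  rw [if_neg (lt_irrefl _), if_pos ⟨rfl, rfl⟩]

/-- At the planted position: the challenge's block. [folklore] -/
theorem posBlk_chal_self {N : ℕ} (τ : List (List Bool × Bool)) (z : List Bool) (pc : List Bool) :
    posBlk N τ true z τ.length pc = z.drop (pubLen N) := by
  unfold posBlk
  rw [if_neg (lt_irrefl _), if_pos ⟨rfl, rfl⟩]

/-- At a position fixed to `(w, c)`: the public part and the block. [folklore] -/
theorem pos_fix_self {N : ℕ} (τ : List (List Bool × Bool)) (w : List Bool) (c : Bool) (pc : List Bool) :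
    posPub f N (τ ++ [(w, c)]) false [] τ.length pc = g f (w ++ pcR N pc) ++ pcS N pc ∧
      posBlk N (τ ++ [(w, c)]) false [] τ.length pc = (if c then pcU N pc else glBits (kL N) N w (pcS N pc)) := by
  have hlen : (τ ++ [(w, c)]).length = τ.length + 1 := by rw [List.length_append, List.length_singleton]
  have hget : (τ ++ [(w, c)]).getD τ.length ([], false) = (w, c) := by
    rw [List.getD_append_right _ _ _ _ le_rfl, Nat.sub_self, List.getD_cons_zero]
  unfold posPub posBlk
  rw [if_pos (show τ.length < (τ ++ [(w, c)]).length by rw [hlen]; omega), if_pos (show τ.length < (τ ++ [(w, c)]).length by rw [hlen]; omega), hget]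
  exact ⟨rfl, rfl⟩

/-- The public part and the block of a real atom. [folklore] -/
theorem atomR_split (hlp : IsLengthPreserving f) {N : ℕ} {w ρ σ : List Bool} (hw : w.length = N) (hρ : ρ.length = rlen N) (hσ : σ.length = kL N * N) :
    (atomR f N w ρ σ).take (pubLen N) = g f (w ++ ρ) ++ σ ∧ (atomR f N w ρ σ).drop (pubLen N) = glBits (kL N) N w σ := by
  have hg := length_g hlp hw hρ
  have hl : (g f (w ++ ρ) ++ σ).length = pubLen N := by rw [List.length_append, hg, hσ, pubLen]
  unfold atomR
  exact ⟨List.take_left' hl, List.drop_left' hl⟩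

/-- The public part and the block of an ideal atom. [folklore] -/
theorem atomI_split (hlp : IsLengthPreserving f) {N : ℕ} {w ρ σ u : List Bool} (hw : w.length = N) (hρ : ρ.length = rlen N) (hσ : σ.length = kL N * N) :
    (atomI f w ρ (σ ++ u)).take (pubLen N) = g f (w ++ ρ) ++ σ ∧ (atomI f w ρ (σ ++ u)).drop (pubLen N) = u := by
  have hg := length_g hlp hw hρ
  have hl : (g f (w ++ ρ) ++ σ).length = pubLen N := by rw [List.length_append, hg, hσ, pubLen]
  unfold atomI
  rw [← List.append_assoc]
  exact ⟨List.take_left' hl, List.drop_left' hl⟩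

/-- **Planting a real atom of `w` at position `|τ| < k` is fixing `(w, 0)` with the atom's `r, σ` in the slots.** [cite: HastadImpagliazzoLevinLuby1999, Lemma 6.3.2 (proof: "E[d^{(j)}(w,R,x⊙Y,Y) − e^{(j)}(w,R,Y)] = δ₀^{(j)}(w)")] -/
theorem samples_chal_real (hlp : IsLengthPreserving f) {N t : ℕ} {τ : List (List Bool × Bool)} (hτ : τ.length < P.kk N) {w ρ σ : List Bool}
    (hw : w.length = N) (hρ : ρ.length = rlen N) (hσ : σ.length = kL N * N) {pcs : List Bool} (hpcs : P.kk N * cP N ≤ pcs.length) (U Z : List Bool) :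
    P.Dsample f N t τ true (atomR f N w ρ σ) pcs U =
        P.Dsample f N t (τ ++ [(w, false)]) false [] (pcs.take (τ.length * cP N + N) ++ (ρ ++ σ) ++ pcs.drop (τ.length * cP N + N + (rlen N + kL N * N))) U ∧
      P.Esample f N τ true (atomR f N w ρ σ) pcs U Z =
        P.Esample f N (τ ++ [(w, false)]) false [] (pcs.take (τ.length * cP N + N) ++ (ρ ++ σ) ++ pcs.drop (τ.length * cP N + N + (rlen N + kL N * N))) U Z := by
  have hr : (τ.length + 1) * cP N ≤ pcs.length := (Nat.mul_le_mul_right _ hτ).trans hpcs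
  have hon : N + (rlen N + kL N * N) ≤ cP N := by unfold cP; omega
  have hxl : (ρ ++ σ).length = rlen N + kL N * N := by rw [List.length_append, hρ, hσ]
  have hblk : N ≤ (Greedy.blkL (cP N) τ.length pcs).length := by rw [length_blkL_of_le hr]; exact le_cP N
  obtain ⟨hz1, hz2⟩ := atomR_split hlp hw hρ hσ
  obtain ⟨hs1, hs2⟩ := slices_chal_real hblk hρ hσ
  have hpubs : P.pubs f N τ true (atomR f N w ρ σ) pcs =
      P.pubs f N (τ ++ [(w, false)]) false [] (pcs.take (τ.length * cP N + N) ++ (ρ ++ σ) ++ pcs.drop (τ.length * cP N + N + (rlen N + kL N * N))) := by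
    unfold pubs
    refine congrArg List.flatten (List.map_congr_left fun i _ => ?_)
    by_cases hi : i = τ.length
    · rw [hi, blkL_owindow_self hon hxl hr, posPub_chal_self, (pos_fix_self (f := f) τ w false _).1, hz1, hs1, hs2]
    · rw [blkL_owindow_ne hon hxl hr hi, posPub_chal_ne τ _ _ hi]
  have hblocks : P.blocks N τ true (atomR f N w ρ σ) pcs =
      P.blocks N (τ ++ [(w, false)]) false [] (pcs.take (τ.length * cP N + N) ++ (ρ ++ σ) ++ pcs.drop (τ.length * cP N + N + (rlen N + kL N * N))) := by
    unfold blocks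
    refine congrArg List.flatten (List.map_congr_left fun i _ => ?_)
    by_cases hi : i = τ.length
    · rw [hi, blkL_owindow_self hon hxl hr, posBlk_chal_self, (pos_fix_self (f := f) τ w false _).2, hz2, hs2]
      rfl
    · rw [blkL_owindow_ne hon hxl hr hi, posBlk_chal_ne τ _ _ hi]
  unfold Dsample Esample
  rw [hpubs, hblocks]
  exact ⟨rfl, rfl⟩

/-- **Planting an ideal atom of `w` at position `|τ| < k` is fixing `(w, 1)` with the atom's `r, σ, u` in the slots.** [cite: HastadImpagliazzoLevinLuby1999, Lemma 6.3.2 (proof: "E[d^{(j)}(w,R,β,Y) − e^{(j)}(w,R,Y)] = δ₁^{(j)}(w)")] -/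
theorem samples_chal_ideal (hlp : IsLengthPreserving f) {N t : ℕ} {τ : List (List Bool × Bool)} (hτ : τ.length < P.kk N) {w ρ σ u : List Bool}
    (hw : w.length = N) (hρ : ρ.length = rlen N) (hσ : σ.length = kL N * N) (hu : u.length = kL N) {pcs : List Bool}
    (hpcs : P.kk N * cP N ≤ pcs.length) (U Z : List Bool) :
    P.Dsample f N t τ true (atomI f w ρ (σ ++ u)) pcs U =
        P.Dsample f N t (τ ++ [(w, true)]) false [] (pcs.take (τ.length * cP N + N) ++ (ρ ++ σ ++ u) ++
          pcs.drop (τ.length * cP N + N + (rlen N + kL N * N + kL N))) U ∧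
      P.Esample f N τ true (atomI f w ρ (σ ++ u)) pcs U Z =
        P.Esample f N (τ ++ [(w, true)]) false [] (pcs.take (τ.length * cP N + N) ++ (ρ ++ σ ++ u) ++
          pcs.drop (τ.length * cP N + N + (rlen N + kL N * N + kL N))) U Z := by
  have hr : (τ.length + 1) * cP N ≤ pcs.length := (Nat.mul_le_mul_right _ hτ).trans hpcs
  have hon : N + (rlen N + kL N * N + kL N) ≤ cP N := by unfold cP; omega
  have hxl : (ρ ++ σ ++ u).length = rlen N + kL N * N + kL N := by rw [List.length_append, List.length_append, hρ, hσ, hu]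
  have hblk : N ≤ (Greedy.blkL (cP N) τ.length pcs).length := by rw [length_blkL_of_le hr]; exact le_cP N
  obtain ⟨hz1, hz2⟩ := atomI_split hlp (u := u) hw hρ hσ
  obtain ⟨hs1, hs2, hs3⟩ := slices_chal_ideal hblk hρ hσ hu
  have hpubs : P.pubs f N τ true (atomI f w ρ (σ ++ u)) pcs =
      P.pubs f N (τ ++ [(w, true)]) false [] (pcs.take (τ.length * cP N + N) ++ (ρ ++ σ ++ u) ++
        pcs.drop (τ.length * cP N + N + (rlen N + kL N * N + kL N))) := by
    unfold pubs
    refine congrArg List.flatten (List.map_congr_left fun i _ => ?_)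
    by_cases hi : i = τ.length
    · rw [hi, blkL_owindow_self hon hxl hr, posPub_chal_self, (pos_fix_self (f := f) τ w true _).1, hz1, hs1, hs2]
    · rw [blkL_owindow_ne hon hxl hr hi, posPub_chal_ne τ _ _ hi]
  have hblocks : P.blocks N τ true (atomI f w ρ (σ ++ u)) pcs =
      P.blocks N (τ ++ [(w, true)]) false [] (pcs.take (τ.length * cP N + N) ++ (ρ ++ σ ++ u) ++
        pcs.drop (τ.length * cP N + N + (rlen N + kL N * N + kL N))) := by
    unfold blocks
    refine congrArg List.flatten (List.map_congr_left fun i _ => ?_)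
    by_cases hi : i = τ.length
    · rw [hi, blkL_owindow_self hon hxl hr, posBlk_chal_self, (pos_fix_self (f := f) τ w true _).2, hz2, if_pos rfl, hs3]
    · rw [blkL_owindow_ne hon hxl hr hi, posBlk_chal_ne τ _ _ hi]
  unfold Dsample Esample
  rw [hpubs, hblocks]
  exact ⟨rfl, rfl⟩

/-- **The runs with a planted atom**, read as runs of the fixed template on window-substituted coins. [folklore] -/
theorem runs_chal_eq (hlp : IsLengthPreserving f) {N t : ℕ} {τ : List (List Bool × Bool)} (hτ : τ.length < P.kk N) {w x : List Bool}
    (hw : w.length = N) {c : Bool} {a : ℕ} (ha : a = rlen N + kL N * N + (if c then kL N else 0)) (hx : x.length = a)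
    {r : List Bool} (hr : P.kk N * cP N ≤ r.length) :
    let z := if c then atomI f w (x.take (rlen N)) (x.drop (rlen N)) else atomR f N w (x.take (rlen N)) (x.drop (rlen N))
    P.runD f A N t τ true z r = P.runD f A N t (τ ++ [(w, c)]) false [] (r.take (τ.length * cP N + N) ++ x ++ r.drop (τ.length * cP N + N + a)) ∧
      P.runE f A N t τ true z r = P.runE f A N t (τ ++ [(w, c)]) false [] (r.take (τ.length * cP N + N) ++ x ++ r.drop (τ.length * cP N + N + a)) := by
  intro z
  have hpN : τ.length * cP N + N + a ≤ P.kk N * cP N := by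
    have := Nat.mul_le_mul_right (cP N) hτ; rw [Nat.succ_mul] at this
    have ha' : N + a ≤ cP N := by rw [ha]; unfold cP; split_ifs <;> omega
    omega
  obtain ⟨h1, h2⟩ := take_window hx hpN hr
  have hpl : P.kk N * cP N ≤ (r.take (P.kk N * cP N)).length := by rw [List.length_take]; omega
  have hρ : (x.take (rlen N)).length = rlen N := by rw [List.length_take, hx, ha]; omega
  have h3 : (r.take (τ.length * cP N + N) ++ x ++ r.drop (τ.length * cP N + N + a)).drop (P.kk N * cP N + P.uLen N t) = r.drop (P.kk N * cP N + P.uLen N t) := by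
    rw [← List.drop_drop, h2, List.drop_drop]
  have h4 : (r.take (τ.length * cP N + N) ++ x ++ r.drop (τ.length * cP N + N + a)).drop (P.kk N * cP N + P.uLen N t + P.mlen N t) =
      r.drop (P.kk N * cP N + P.uLen N t + P.mlen N t) := by
    rw [← List.drop_drop, h3, List.drop_drop]
  cases c with
  | false =>
    have hσ : (x.drop (rlen N)).length = kL N * N := by rw [List.length_drop, hx, ha]; simp
    have hxe : x = x.take (rlen N) ++ x.drop (rlen N) := (List.take_append_drop _ _).symm
    obtain ⟨hD, hE⟩ := samples_chal_real (P := P) (t := t) hlp hτ hw hρ hσ hpl ((r.drop (P.kk N * cP N)).take (P.uLen N t))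
      ((r.drop (P.kk N * cP N + P.uLen N t)).take (P.mlen N t))
    rw [← hxe] at hD hE
    have ha0 : a = rlen N + kL N * N := by rw [ha]; simp
    subst ha0
    unfold runD runE
    rw [h1, h2, h3, h4, ← hD, ← hE]
    exact ⟨rfl, rfl⟩
  | true =>
    have hσ : ((x.drop (rlen N)).take (kL N * N)).length = kL N * N := by rw [List.length_take, List.length_drop, hx, ha]; simp; omega
    have hu : ((x.drop (rlen N)).drop (kL N * N)).length = kL N := by rw [List.length_drop, List.length_drop, hx, ha]; simp; omega
    have hxe : x = x.take (rlen N) ++ (x.drop (rlen N)).take (kL N * N) ++ (x.drop (rlen N)).drop (kL N * N) := by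
      rw [List.append_assoc, List.take_append_drop, List.take_append_drop]
    have hze : z = atomI f w (x.take (rlen N)) ((x.drop (rlen N)).take (kL N * N) ++ (x.drop (rlen N)).drop (kL N * N)) := by
      show atomI f w (x.take (rlen N)) (x.drop (rlen N)) = _
      rw [List.take_append_drop]
    obtain ⟨hD, hE⟩ := samples_chal_ideal (P := P) (t := t) hlp hτ hw hρ hσ hu hpl ((r.drop (P.kk N * cP N)).take (P.uLen N t))
      ((r.drop (P.kk N * cP N + P.uLen N t)).take (P.mlen N t))
    rw [← hxe] at hD hE
    have ha0 : a = rlen N + kL N * N + kL N := by rw [ha]; simp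
    subst ha0
    rw [hze]
    unfold runD runE
    rw [h1, h2, h3, h4, ← hD, ← hE]
    exact ⟨rfl, rfl⟩

/-! ### Averages: `d` and `e` over the atom's randomness -/

variable (P f A) in
/-- `d(τ, z) = Pr_coins[A(𝒟^{(τ)} with z planted at position |τ|) = 1]`. [cite: HastadImpagliazzoLevinLuby1999, Lemma 6.3.2 (proof: d^{(j)}(w,r,b,y))] -/
noncomputable def dChal (N t : ℕ) (τ : List (List Bool × Bool)) (z : List Bool) : ℝ :=
  uniformAvg (P.dTot A N t) fun r => Greedy.ind (P.runD f A N t τ true z r = true)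

variable (P f A) in
/-- `e(τ, z) = Pr_coins[A(ℰ^{(τ)} with z planted) = 1]`. [cite: HastadImpagliazzoLevinLuby1999, Lemma 6.3.2 (proof: e^{(j)}(w,r,y))] -/
noncomputable def eChal (N t : ℕ) (τ : List (List Bool × Bool)) (z : List Bool) : ℝ :=
  uniformAvg (P.eTot A N t) fun r => Greedy.ind (P.runE f A N t τ true z r = true)

variable (f) in
/-- The atom of kind `c` of `w` with randomness `x = r ‖ σ (‖ u)`. [folklore] -/
noncomputable def atomOf (c : Bool) (N : ℕ) (w x : List Bool) : List Bool :=
  if c then atomI f w (x.take (rlen N)) (x.drop (rlen N)) else atomR f N w (x.take (rlen N)) (x.drop (rlen N))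

/-- The length of the atom's randomness. [folklore] -/
def aLen (c : Bool) (N : ℕ) : ℕ := rlen N + kL N * N + (if c then kL N else 0)

/-- **`E_{atom randomness}[d(τ, atom_c(w))] = Pr[A(𝒟^{(τ·(w,c))}) = 1]`** and the same for `e`
(`|τ| < k`, `|w| = N`). [cite: HastadImpagliazzoLevinLuby1999, Lemma 6.3.2 (proof: "it follows directly from the definitions")] -/
theorem avg_chal_eq (hlp : IsLengthPreserving f) {N t : ℕ} {τ : List (List Bool × Bool)} (hτ : τ.length < P.kk N) {w : List Bool}
    (hw : w.length = N) (c : Bool) :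
    uniformAvg (aLen c N) (fun x => P.dChal f A N t τ (atomOf f c N w x)) = P.accD f A N t (τ ++ [(w, c)]) ∧
      uniformAvg (aLen c N) (fun x => P.eChal f A N t τ (atomOf f c N w x)) = P.accE f A N t (τ ++ [(w, c)]) := by
  have hpN : τ.length * cP N + N + aLen c N ≤ P.kk N * cP N := by
    have := Nat.mul_le_mul_right (cP N) hτ; rw [Nat.succ_mul] at this
    have ha' : N + aLen c N ≤ cP N := by unfold aLen cP; split_ifs <;> omega
    omega
  obtain ⟨cD, hcD⟩ : ∃ k, P.dTot A N t = τ.length * cP N + N + aLen c N + k := ⟨_, (Nat.add_sub_cancel' (hpN.trans (by unfold dTot; omega))).symm⟩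
  obtain ⟨cE, hcE⟩ : ∃ k, P.eTot A N t = τ.length * cP N + N + aLen c N + k := ⟨_, (Nat.add_sub_cancel' (hpN.trans (by unfold eTot; omega))).symm⟩
  constructor
  · have hW := uniformAvg_window (τ.length * cP N + N) (aLen c N) cD (fun r => Greedy.ind (P.runD f A N t (τ ++ [(w, c)]) false [] r = true))
    rw [← hcD] at hW
    rw [accD, ← hW]
    refine uniformAvg_congr fun x hx => ?_
    rw [dChal]
    refine uniformAvg_congr fun r hr => ?_
    rw [atomOf, (runs_chal_eq (A := A) (t := t) hlp hτ hw (c := c) rfl hx (by rw [hr]; unfold dTot; omega)).1]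
    rfl
  · have hW := uniformAvg_window (τ.length * cP N + N) (aLen c N) cE (fun r => Greedy.ind (P.runE f A N t (τ ++ [(w, c)]) false [] r = true))
    rw [← hcE] at hW
    rw [accE, ← hW]
    refine uniformAvg_congr fun x hx => ?_
    rw [eChal]
    refine uniformAvg_congr fun r hr => ?_
    rw [atomOf, (runs_chal_eq (A := A) (t := t) hlp hτ hw (c := c) rfl hx (by rw [hr]; unfold eTot; omega)).2]
    rfl

/-! ### The output rule: `Pr[M = 1] = ½ + (d − e)/2` -/

/-- `E_{U_1} g = ½ (g 0 + g 1)` (private twin of `ComPRGHiding.uniformAvg_one`, not in this file's import closure). [folklore] -/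
private theorem uniformAvg_one (G : List Bool → ℝ) : uniformAvg 1 G = 2⁻¹ * (G [false] + G [true]) := by
  show (∑ x : List.Vector Bool 1, G x.toList) / 2 ^ 1 = _
  have huniv : (Finset.univ : Finset (List.Vector Bool 1)) = {⟨[false], rfl⟩, ⟨[true], rfl⟩} := by
    ext v
    simp only [Finset.mem_univ, Finset.mem_insert, Finset.mem_singleton, true_iff]
    obtain ⟨l, hl⟩ := v
    match l, hl with
    | [b], _ => cases b <;> simp
  rw [huniv, Finset.sum_pair (by decide)]
  simp only [List.Vector.toList_mk, pow_one]
  ring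

variable (P f A) in
/-- **The Phase-2 output** on template `τ`, atom `z` and Phase-2 coins `r = r_D ‖ r_E ‖ β ‖ …`:
`β` if `A(D) = A(E)`, else `A(D)`. [cite: HastadImpagliazzoLevinLuby1999, Lemma 6.3.2 (proof, Phase 2)] -/
noncomputable def out2 (N t : ℕ) (τ : List (List Bool × Bool)) (z r : List Bool) : Bool :=
  let aD := P.runD f A N t τ true z (r.take (P.dTot A N t))
  let aE := P.runE f A N t τ true z ((r.drop (P.dTot A N t)).take (P.eTot A N t))
  let β := ((r.drop (P.dTot A N t + P.eTot A N t)).take 1 = [true])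
  if aD = aE then decide β else aD

/-- The machine's rule is `out2` on the machine's template and the coins after Phase 1. [folklore] -/
theorem outM_eq_out2 {NsP τnP : Polynomial ℕ} (N t j : ℕ) (z R : List Bool) :
    P.outM f A NsP τnP N t j z R = P.out2 f A N t (P.tmplM f A NsP τnP N t R j) z (R.drop (j * (P.QM f A NsP τnP N t).cS)) := rfl

/-- **`Pr[M = 1] = ½ + (d − e)/2`** over the Phase-2 coins (any budget `L ≥ dTot + eTot + 1`).
[cite: HastadImpagliazzoLevinLuby1999, Lemma 6.3.2 (proof: "Pr[M^{(A)}(f'(w,r),b,y) = 1] = 1/2 + (d^{(j)}(w,r,b,y) − e^{(j)}(w,r,y))/2")] -/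
theorem avg_out2 {N t : ℕ} (τ : List (List Bool × Bool)) (z : List Bool) {L : ℕ} (hL : P.dTot A N t + P.eTot A N t + 1 ≤ L) :
    uniformAvg L (fun r => Greedy.ind (P.out2 f A N t τ z r = true)) = 1 / 2 + (P.dChal f A N t τ z - P.eChal f A N t τ z) / 2 := by
  obtain ⟨L', rfl⟩ : ∃ L', L = P.dTot A N t + (P.eTot A N t + (1 + L')) := ⟨L - (P.dTot A N t + P.eTot A N t + 1), by omega⟩
  -- the value on split coins
  set G : Bool → Bool → List Bool → ℝ := fun aD aE b => Greedy.ind ((if aD = aE then decide (b = [true]) else aD) = true) with hG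
  have hval : ∀ rD, rD.length = P.dTot A N t → ∀ rE, rE.length = P.eTot A N t → ∀ b, b.length = 1 → ∀ junk : List Bool,
      Greedy.ind (P.out2 f A N t τ z (rD ++ (rE ++ (b ++ junk))) = true) =
        G (P.runD f A N t τ true z rD) (P.runE f A N t τ true z rE) b := by
    intro rD hD rE hE b hb junk
    have h1 : (rD ++ (rE ++ (b ++ junk))).take (P.dTot A N t) = rD := List.take_left' hD
    have h2 : ((rD ++ (rE ++ (b ++ junk))).drop (P.dTot A N t)).take (P.eTot A N t) = rE := by rw [List.drop_left' hD, List.take_left' hE]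
    have h3 : ((rD ++ (rE ++ (b ++ junk))).drop (P.dTot A N t + P.eTot A N t)).take 1 = b := by
      rw [← List.drop_drop, List.drop_left' hD, List.drop_left' hE, List.take_left' hb]
    simp only [out2, h1, h2, h3, hG]
  -- average over `β`
  have hβ : ∀ aD aE : Bool, uniformAvg (1 + L') (fun w => G aD aE (w.take 1)) = if aD = aE then 1 / 2 else Greedy.ind (aD = true) := by
    intro aD aE
    rw [uniformAvg_take, uniformAvg_one]
    simp only [hG]
    cases aD <;> cases aE <;> simp [Greedy.ind_of_true, Greedy.ind_of_false]
    all_goals norm_num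
  -- average over `r_E`
  have hE : ∀ aD : Bool, uniformAvg (P.eTot A N t) (fun rE => if aD = P.runE f A N t τ true z rE then (1 : ℝ) / 2 else Greedy.ind (aD = true)) =
      Greedy.ind (aD = true) * (1 - P.eChal f A N t τ z / 2) + (1 - Greedy.ind (aD = true)) * ((1 - P.eChal f A N t τ z) / 2) := by
    intro aD
    have e1 : (fun rE => if aD = P.runE f A N t τ true z rE then (1 : ℝ) / 2 else Greedy.ind (aD = true)) =
        fun rE => (Greedy.ind (aD = true) * 1 + (1 - Greedy.ind (aD = true)) * (1 / 2)) +
          (-(Greedy.ind (aD = true)) * (1 / 2) + (1 - Greedy.ind (aD = true)) * (-(1 / 2))) * Greedy.ind (P.runE f A N t τ true z rE = true) := by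
      funext rE
      cases aD <;> cases P.runE f A N t τ true z rE <;> simp [Greedy.ind_of_true, Greedy.ind_of_false]
      all_goals norm_num
    rw [e1, uniformAvg_add_fun, uniformAvg_const, uniformAvg_const_mul, eChal]
    ring
  -- assemble
  rw [uniformAvg_append]
  have step : ∀ rD, rD.length = P.dTot A N t →
      uniformAvg (P.eTot A N t + (1 + L')) (fun w => Greedy.ind (P.out2 f A N t τ z (rD ++ w) = true)) =
        Greedy.ind (P.runD f A N t τ true z rD = true) * (1 - P.eChal f A N t τ z / 2) +
          (1 - Greedy.ind (P.runD f A N t τ true z rD = true)) * ((1 - P.eChal f A N t τ z) / 2) := by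
    intro rD hD
    rw [uniformAvg_append, ← hE]
    refine uniformAvg_congr fun rE hrE => ?_
    rw [← hβ]
    refine uniformAvg_congr fun w hw => ?_
    have hw1 : (w.take 1).length = 1 := by rw [List.length_take, hw]; omega
    rw [← List.take_append_drop 1 w, hval rD hD rE hrE _ hw1, List.take_left' hw1]
  rw [uniformAvg_congr fun rD hD => step rD hD, uniformAvg_add_fun]
  have e2 : (fun rD => (1 - Greedy.ind (P.runD f A N t τ true z rD = true)) * ((1 - P.eChal f A N t τ z) / 2)) =
      fun rD => (1 - P.eChal f A N t τ z) / 2 + (-((1 - P.eChal f A N t τ z) / 2)) * Greedy.ind (P.runD f A N t τ true z rD = true) := by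
    funext rD; ring
  have e3 : (fun rD => Greedy.ind (P.runD f A N t τ true z rD = true) * (1 - P.eChal f A N t τ z / 2)) =
      fun rD => (1 - P.eChal f A N t τ z / 2) * Greedy.ind (P.runD f A N t τ true z rD = true) := by
    funext rD; ring
  rw [e2, e3, uniformAvg_add_fun, uniformAvg_const, uniformAvg_const_mul, uniformAvg_const_mul, dChal]
  ring

/-! ### The machine's acceptance probability on a planted atom -/

variable {NsP τnP : Polynomial ℕ}

/-- The machine's template only reads the first `j·cS` coins. [folklore] -/
theorem tmplM_take {N : ℕ} (hτn : 1 ≤ τnP.eval N) (t j : ℕ) (R : List Bool) :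
    P.tmplM f A NsP τnP N t (R.take (j * (P.QM f A NsP τnP N t).cS)) j = P.tmplM f A NsP τnP N t R j := by
  rw [← templateOf_eq_tmplM hτn, ← templateOf_eq_tmplM hτn, Greedy.Data.templateOf_take _ (show 1 ≤ (P.QM f A NsP τnP N t).τn from hτn)]

/-- **`E_R[M outputs 1 on z] = ½ + E_{R₁}[d(T_j(R₁), z) − e(T_j(R₁), z)]/2`** (`R = R₁ ‖ Phase-2 coins`, budget
`L ≥ j·cS + dTot + eTot + 1`). [cite: HastadImpagliazzoLevinLuby1999, Lemma 6.3.2 (proof, Phase 2)] -/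
theorem avg_outM {N t j : ℕ} (hτn : 1 ≤ τnP.eval N) (z : List Bool) {L : ℕ}
    (hL : j * (P.QM f A NsP τnP N t).cS + P.dTot A N t + P.eTot A N t + 1 ≤ L) :
    uniformAvg L (fun R => Greedy.ind (P.outM f A NsP τnP N t j z R = true)) =
      1 / 2 + uniformAvg (j * (P.QM f A NsP τnP N t).cS) (fun R₁ =>
        P.dChal f A N t (P.tmplM f A NsP τnP N t R₁ j) z - P.eChal f A N t (P.tmplM f A NsP τnP N t R₁ j) z) / 2 := by
  obtain ⟨L', rfl⟩ : ∃ L', L = j * (P.QM f A NsP τnP N t).cS + L' := ⟨L - j * (P.QM f A NsP τnP N t).cS, by omega⟩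
  have hL' : P.dTot A N t + P.eTot A N t + 1 ≤ L' := by omega
  rw [uniformAvg_append]
  have step : ∀ R₁ : List Bool, R₁.length = j * (P.QM f A NsP τnP N t).cS →
      uniformAvg L' (fun w => Greedy.ind (P.outM f A NsP τnP N t j z (R₁ ++ w) = true)) =
        1 / 2 + (P.dChal f A N t (P.tmplM f A NsP τnP N t R₁ j) z - P.eChal f A N t (P.tmplM f A NsP τnP N t R₁ j) z) / 2 := by
    intro R₁ hR₁
    rw [← avg_out2 _ z hL']
    refine uniformAvg_congr fun w _ => ?_
    rw [outM_eq_out2, List.drop_left' hR₁, ← tmplM_take hτn t j (R₁ ++ w), List.take_left' hR₁]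
  rw [uniformAvg_congr fun R₁ h => step R₁ h, uniformAvg_add_fun, uniformAvg_const, show (fun R₁ : List Bool =>
    (P.dChal f A N t (P.tmplM f A NsP τnP N t R₁ j) z - P.eChal f A N t (P.tmplM f A NsP τnP N t R₁ j) z) / 2) = fun R₁ =>
      (1 / 2 : ℝ) * (P.dChal f A N t (P.tmplM f A NsP τnP N t R₁ j) z - P.eChal f A N t (P.tmplM f A NsP τnP N t R₁ j) z) from
    funext fun _ => by ring, uniformAvg_const_mul]
  ring

/-- **Averaged over the atoms of `w`**: `E_{atom, R}[M = 1] = ½ + E_{R₁}[δ^{(T_j ·(w,c))}]/2` (`j < k`, `|w| = N`).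
[cite: HastadImpagliazzoLevinLuby1999, Lemma 6.3.2 (proof: the two displayed expectations)] -/
theorem avg_atom_outM (hlp : IsLengthPreserving f) {N t j : ℕ} (hτn : 1 ≤ τnP.eval N) (hj : j < P.kk N) {w : List Bool} (hw : w.length = N)
    (c : Bool) {L : ℕ} (hL : j * (P.QM f A NsP τnP N t).cS + P.dTot A N t + P.eTot A N t + 1 ≤ L) :
    uniformAvg (aLen c N) (fun x => uniformAvg L fun R => Greedy.ind (P.outM f A NsP τnP N t j (atomOf f c N w x) R = true)) =
      1 / 2 + uniformAvg (j * (P.QM f A NsP τnP N t).cS) (fun R₁ => P.delta f A N t (P.tmplM f A NsP τnP N t R₁ j ++ [(w, c)])) / 2 := by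
  simp only [avg_outM hτn _ hL]
  rw [uniformAvg_add_fun, uniformAvg_const]
  congr 1
  have e1 : (fun x => uniformAvg (j * (P.QM f A NsP τnP N t).cS) (fun R₁ =>
      P.dChal f A N t (P.tmplM f A NsP τnP N t R₁ j) (atomOf f c N w x) - P.eChal f A N t (P.tmplM f A NsP τnP N t R₁ j) (atomOf f c N w x)) / 2) =
      fun x => (1 / 2 : ℝ) * uniformAvg (j * (P.QM f A NsP τnP N t).cS) (fun R₁ =>
        P.dChal f A N t (P.tmplM f A NsP τnP N t R₁ j) (atomOf f c N w x) - P.eChal f A N t (P.tmplM f A NsP τnP N t R₁ j) (atomOf f c N w x)) := by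
    funext x; ring
  rw [e1, uniformAvg_const_mul, uniformAvg_comm]
  have hlen : ∀ R₁ : List Bool, (P.tmplM f A NsP τnP N t R₁ j).length = j := fun R₁ => by
    rw [← templateOf_eq_tmplM hτn]; exact Greedy.Data.length_templateOf _ _ _
  have e2 : ∀ R₁ : List Bool, uniformAvg (aLen c N) (fun x => P.dChal f A N t (P.tmplM f A NsP τnP N t R₁ j) (atomOf f c N w x) -
      P.eChal f A N t (P.tmplM f A NsP τnP N t R₁ j) (atomOf f c N w x)) = P.delta f A N t (P.tmplM f A NsP τnP N t R₁ j ++ [(w, c)]) := by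
    intro R₁
    obtain ⟨hd, he⟩ := avg_chal_eq (P := P) (A := A) (t := t) hlp (τ := P.tmplM f A NsP τnP N t R₁ j) (by rw [hlen]; exact hj) hw c
    rw [uniformAvg_sub_fun, hd, he, delta]
  simp only [e2]
  ring

/-! ### Over the Goldreich–Levin ensembles of `HILLAtoms` -/

/-- A finite sum of uniform averages. [folklore] -/
private theorem uniformAvg_finset_sum {ι : Type*} (s : Finset ι) (k : ℕ) (F : ι → List Bool → ℝ) :
    uniformAvg k (fun r => ∑ i ∈ s, F i r) = ∑ i ∈ s, uniformAvg k (F i) := by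
  unfold uniformAvg
  rw [← Finset.sum_div, Finset.sum_comm]

/-- Dividing a uniform average by a constant. [folklore] -/
private theorem uniformAvg_div_const (k : ℕ) (F : List Bool → ℝ) (c : ℝ) : uniformAvg k (fun r => F r / c) = uniformAvg k F / c := by
  simp only [div_eq_mul_inv]
  unfold uniformAvg
  rw [← Finset.sum_mul]
  ring

/-- Length of an atom of kind `c`. [folklore] -/
theorem length_atomOf (hlp : IsLengthPreserving f) (c : Bool) {N : ℕ} {w x : List Bool} (hw : w.length = N) (hx : x.length = aLen c N) :
    (atomOf f c N w x).length = La N := by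
  have hρ : (x.take (rlen N)).length = rlen N := by rw [List.length_take, hx]; unfold aLen; exact min_eq_left (by omega)
  cases c with
  | false => exact length_atomR hlp hw hρ (by rw [List.length_drop, hx]; unfold aLen; simp)
  | true => exact length_atomI hlp hw hρ (by rw [List.length_drop, hx]; unfold aLen; simp; omega)

/-- **`Pr[M(1^N, real atom) = 1]`** as the average over `w ∈ 𝒯̃`, the atom's randomness and the machine's coins
(coin count `L` on inputs of length `2N + 2 + La N`). [folklore] -/
theorem toReal_acceptPMF_gl (hlp : IsLengthPreserving f) (M : RandAlg (List Bool) Bool) (N : ℕ) {L : ℕ}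
    (hcl : M.coinLen (2 * N + 2 + La N) = L) (c : Bool) :
    (acceptPMF M N ((if c then glIdealEns (g f) (Tt f) rlen 1 else glRealEns (g f) (Tt f) rlen 1) N) true).toReal =
      (∑ w ∈ Tt f N, uniformAvg (aLen c N) fun x => uniformAvg L fun R =>
        Greedy.ind (M.run (boolPair (unaryEncodeNat N) (atomOf f c N w.toList x)) R = true)) / (Tt f N).card := by
  classical
  have hTt := Tt_nonempty f N
  have hcard : (0 : ℝ) < (Tt f N).card := by exact_mod_cast hTt.card_pos
  -- the common shape
  have key : ∀ (b : ℕ) (G : List Bool → List Bool), b = aLen c N → (∀ w ∈ Tt f N, ∀ x : List Bool, x.length = b → G (w.toList ++ x) = atomOf f c N w.toList x) →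
      (acceptPMF M N ((condUniform (blockSeeds (Tt f) b N)).map G) true).toReal =
        (∑ w ∈ Tt f N, uniformAvg (aLen c N) fun x => uniformAvg L fun R =>
          Greedy.ind (M.run (boolPair (unaryEncodeNat N) (atomOf f c N w.toList x)) R = true)) / (Tt f N).card := by
    intro b G hb hG
    have hbS : (blockSeeds (Tt f) b N).Nonempty := blockSeeds_nonempty_iff.2 hTt
    rw [toReal_acceptPMF_condUniform_map M N hbS, GLEns.sum_blockSeeds, card_blockSeeds]
    have hterm : ∀ w ∈ Tt f N, ∀ u : List.Vector Bool b, M.pr id (boolPair (unaryEncodeNat N) (G (w.toList ++ u.toList))) {true} =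
        uniformAvg L fun R => Greedy.ind (M.run (boolPair (unaryEncodeNat N) (atomOf f c N w.toList u.toList)) R = true) := by
      intro w hw u
      rw [hG w hw u.toList (by rw [List.Vector.toList_length]), LenPres.pr_eq_uniformAvg_ite M id _ {true} (k := L) (by
        rw [id, length_boolPair, show (unaryEncodeNat N).length = N from unary_decode_encode_nat N,
          length_atomOf hlp c (List.Vector.toList_length w) (by rw [List.Vector.toList_length, hb]), ← hcl])]
      refine uniformAvg_congr fun R _ => ?_
      by_cases h : M.run (boolPair (unaryEncodeNat N) (atomOf f c N w.toList u.toList)) R = true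
      · rw [Greedy.ind_of_true h, if_pos (by simpa using h)]
      · rw [Greedy.ind_of_false h, if_neg (by simpa using h)]
    rw [Finset.sum_congr rfl fun w hw => Finset.sum_congr rfl fun u _ => hterm w hw u]
    have hsum : ∀ w ∈ Tt f N, ∑ u : List.Vector Bool b, uniformAvg L (fun R => Greedy.ind (M.run (boolPair (unaryEncodeNat N) (atomOf f c N w.toList u.toList)) R = true)) =
        2 ^ b * uniformAvg (aLen c N) (fun x => uniformAvg L fun R => Greedy.ind (M.run (boolPair (unaryEncodeNat N) (atomOf f c N w.toList x)) R = true)) := by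
      intro w _
      rw [← hb, uniformAvg, mul_div_cancel₀ _ (by positivity)]
    rw [Finset.sum_congr rfl hsum, ← Finset.mul_sum]
    push_cast
    field_simp
  cases c with
  | false =>
    refine key (rlen N + 1 * Nat.log 2 N * N) (glReal (g f) (rlen N) (1 * Nat.log 2 N) N) (by unfold aLen kL; simp) fun w _ x hx => ?_
    have hρ : (x.take (rlen N)).length = rlen N := by rw [List.length_take, hx]; exact min_eq_left (by omega)
    have hσ : (x.drop (rlen N)).length = kL N * N := by rw [List.length_drop, hx, kL]; simp
    rw [show w.toList ++ x = w.toList ++ x.take (rlen N) ++ x.drop (rlen N) by rw [List.append_assoc, List.take_append_drop], one_mul,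
      show Nat.log 2 N = kL N from rfl, glReal_eq (List.Vector.toList_length w) hρ hσ]
    rfl
  | true =>
    refine key (rlen N + 1 * Nat.log 2 N * N + 1 * Nat.log 2 N) (glIdeal (g f) (rlen N) N) (by unfold aLen kL; simp) fun w _ x hx => ?_
    have hρ : (x.take (rlen N)).length = rlen N := by rw [List.length_take, hx]; exact min_eq_left (by omega)
    rw [show w.toList ++ x = w.toList ++ x.take (rlen N) ++ x.drop (rlen N) by rw [List.append_assoc, List.take_append_drop],
      glIdeal_eq (List.Vector.toList_length w) hρ]
    rfl

/-- **The distinguishing probability of `M^{(A)}` between the real and the ideal atoms is `E_j[ε]/2`**: for any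
machine whose run on `⟨1^N, z⟩` with `L` coins is the rule `outM` at stage index `j < k`,
`Pr[M = 1 | real] − Pr[M = 1 | ideal] = E_{R₁}[ε(T_j(R₁))]/2`.
[cite: HastadImpagliazzoLevinLuby1999, Lemma 6.3.2 (proof: "the distinguishing probability of M^{(A)} is … E_j[ε^{(j)}]/2")] -/
theorem prR_sub_prI (hlp : IsLengthPreserving f) (M : RandAlg (List Bool) Bool) {N t j L : ℕ} {ρf : ℕ → ℝ}
    (hcl : M.coinLen (2 * N + 2 + La N) = L) (hτn : 1 ≤ τnP.eval N) (hj : j < P.kk N)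
    (hL : j * (P.QM f A NsP τnP N t).cS + P.dTot A N t + P.eTot A N t + 1 ≤ L) (ht : t = tStar f N)
    (hrun : ∀ z R : List Bool, z.length = La N → R.length = L → M.run (boolPair (unaryEncodeNat N) z) R = P.outM f A NsP τnP N t j z R) :
    (acceptPMF M N (glRealEns (g f) (Tt f) rlen 1 N) true).toReal - (acceptPMF M N (glIdealEns (g f) (Tt f) rlen 1 N) true).toReal =
      (P.QD f A NsP τnP ρf N).Ej j (P.QD f A NsP τnP ρf N).ε / 2 := by
  subst ht
  have hR := toReal_acceptPMF_gl (f := f) hlp M N hcl false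
  have hI := toReal_acceptPMF_gl (f := f) hlp M N hcl true
  simp only [Bool.false_eq_true, if_false, if_true] at hR hI
  rw [hR, hI, ← sub_div, ← Finset.sum_sub_distrib]
  have hw : ∀ w : List.Vector Bool N, w.toList.length = N := fun w => List.Vector.toList_length w
  have hterm : ∀ w ∈ Tt f N, ∀ c : Bool,
      uniformAvg (aLen c N) (fun x => uniformAvg L fun R => Greedy.ind (M.run (boolPair (unaryEncodeNat N) (atomOf f c N w.toList x)) R = true)) =
        1 / 2 + uniformAvg (j * (P.QM f A NsP τnP N (tStar f N)).cS) (fun R₁ =>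
          P.delta f A N (tStar f N) (P.tmplM f A NsP τnP N (tStar f N) R₁ j ++ [(w.toList, c)])) / 2 := by
    intro w _ c
    rw [← avg_atom_outM hlp hτn hj (hw w) c hL]
    refine uniformAvg_congr fun x hx => uniformAvg_congr fun R hRl => ?_
    rw [hrun _ _ (length_atomOf hlp c (hw w) hx) hRl]
  rw [Finset.sum_congr rfl fun w hw' => by rw [hterm w hw' false, hterm w hw' true]]
  -- the right-hand side
  rw [Greedy.Data.Ej, QD_templateOf, QD_cS]
  change _ = uniformAvg (j * (P.QM f A NsP τnP N (tStar f N)).cS) (fun cc => (∑ w ∈ Tt f N,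
      (P.delta f A N (tStar f N) ((P.QM f A NsP τnP N (tStar f N)).templateOf j cc ++ [(w.toList, false)]) -
        P.delta f A N (tStar f N) ((P.QM f A NsP τnP N (tStar f N)).templateOf j cc ++ [(w.toList, true)]))) / (Tt f N).card) / 2
  simp only [templateOf_eq_tmplM hτn, uniformAvg_div_const, uniformAvg_finset_sum, uniformAvg_sub_fun]
  have e : ∀ w : List.Vector Bool N, (1 : ℝ) / 2 + uniformAvg (j * (P.QM f A NsP τnP N (tStar f N)).cS) (fun R₁ =>
      P.delta f A N (tStar f N) (P.tmplM f A NsP τnP N (tStar f N) R₁ j ++ [(w.toList, false)])) / 2 -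
      (1 / 2 + uniformAvg (j * (P.QM f A NsP τnP N (tStar f N)).cS) (fun R₁ =>
        P.delta f A N (tStar f N) (P.tmplM f A NsP τnP N (tStar f N) R₁ j ++ [(w.toList, true)])) / 2) =
      (uniformAvg (j * (P.QM f A NsP τnP N (tStar f N)).cS) (fun R₁ => P.delta f A N (tStar f N) (P.tmplM f A NsP τnP N (tStar f N) R₁ j ++ [(w.toList, false)])) -
        uniformAvg (j * (P.QM f A NsP τnP N (tStar f N)).cS) (fun R₁ => P.delta f A N (tStar f N) (P.tmplM f A NsP τnP N (tStar f N) R₁ j ++ [(w.toList, true)]))) / 2 := by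
    intro w; ring
  simp only [e, ← Finset.sum_div]
  rw [div_right_comm]

end Params

end GH

end HILL

end Literature.Computability.Cryptography

/-!
## Part II — HILL Lemma 6.3.2 assembled: `𝒟 ≈_c ℰ` for the false-entropy samplers (Håstad–Impagliazzo–Levin–Luby 1999, §6.3)

> **Lemma 6.3.2** If `A` is an adversary for distinguishing `𝒟` and `ℰ` with success probability `δₙ` then
> there is an oracle TM `M^{(A)}` that distinguishes the distributions of Lemma 6.1.1 with probability `δₙ/(16kₙ)`,
> whose running time is polynomial in the running time of `A`, `1/δ_A(n)`, and `n`. [HILL 1999, §6.3]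

Combining `HILLGreedySelection` (the stage-sum argument), `HILLGreedyLaws`/`HILLGreedyLeftover` (the laws of the
concrete data, claim (a)), `HILLGreedyMachine` (the machine) and Part I (its distinguishing
probability) with the hiding of `f'` over `𝒯̃` (`HILLAtoms.isCompIndistinguishable_gl`, Lemma 6.1.1), Part II
proves `isCompIndistinguishable_DE`: for a one-way, length-preserving `f` the samplers `𝒟_N` (hash of the hidden
GL blocks ‖ public parts ‖ key) and `ℰ_N` (uniform ‖ public parts ‖ key) of level `N` with the advice
`t*(N)` are computationally indistinguishable — the uniform, mildly non-uniform (advice `p̃ₙ`, HILL Prop. 4.8.1)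
heart of the proof that one-way functions give pseudorandom generators.

Sections: the two ensembles and a distinguisher's gap (`acceptPMF_Dens`, `acceptPMF_Eens`; the output flip
`flipAlg`); the coin budget of the machine (`Kb`, `need_le_code`); the budget read off the input length (`lvlN`,
`clM`); the parameters `τ(N)`, `Ns(N)`, `ρ(N)` for a gap exponent `c₀` and their asymptotics; the contradiction.
No new named facts.
-/

namespace Literature.Computability.Cryptography

open Finset Filter _root_.Computability Complexity HCProd Polynomial Real

namespace HILL

open GAvg

namespace GH

namespace Params

variable {P : Params} {f : List Bool → List Bool} {A : RandAlg (List Bool) Bool}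

/-! ### The two ensembles and a distinguisher's gap -/

variable (P f) in
/-- **`𝒟_N`**: the false-entropy sampler's output `h'_U(blocks) ‖ pubs ‖ U` at level `N` with the advice `t*(N)`.
[cite: HastadImpagliazzoLevinLuby1999, §6.2 eq. (8) and Thm 6.2.1 (the distribution 𝒟)] -/
noncomputable def Dens (N : ℕ) : PMF (List Bool) :=
  (uniformBits (P.kk N * cP N + P.uLen N (tStar f N))).map fun r =>
    P.Dsample f N (tStar f N) [] false [] (r.take (P.kk N * cP N)) (r.drop (P.kk N * cP N))

variable (P f) in
/-- **`ℰ_N`**: the same with the hashed value replaced by fresh uniform bits. [cite: HastadImpagliazzoLevinLuby1999, Thm 6.2.1 (the distribution ℰ)] -/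
noncomputable def Eens (N : ℕ) : PMF (List Bool) :=
  (uniformBits (P.kk N * cP N + P.uLen N (tStar f N) + P.mlen N (tStar f N))).map fun r =>
    P.Esample f N [] false [] (r.take (P.kk N * cP N)) ((r.drop (P.kk N * cP N)).take (P.uLen N (tStar f N)))
      (r.drop (P.kk N * cP N + P.uLen N (tStar f N)))

/-- A `{0,1}`-valued `if` is the indicator. [folklore] -/
private theorem ite_mem_singleton_eq_ind (b : Bool) : (if b ∈ ({true} : Set Bool) then (1 : ℝ) else 0) = Greedy.ind (b = true) := by
  by_cases h : b = true
  · rw [Greedy.ind_of_true h, if_pos (by simpa using h)]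
  · rw [Greedy.ind_of_false h, if_neg (by simpa using h)]

/-- **`Pr[A(1^N, 𝒟_N) = 1] = Pr[A(𝒟^{(ε)}) = 1]`** (the empty template). [folklore] -/
theorem acceptPMF_Dens (hlp : IsLengthPreserving f) (A : RandAlg (List Bool) Bool) (N : ℕ) :
    (acceptPMF A N (P.Dens f N) true).toReal = P.accD f A N (tStar f N) [] := by
  rw [Dens, acceptPMF_map_uniformBits_toReal, accD, dTot]
  conv_rhs => rw [uniformAvg_append]
  refine uniformAvg_congr fun s hs => ?_
  have hpcs : (s.take (P.kk N * cP N)).length = P.kk N * cP N := by rw [List.length_take, hs]; exact min_eq_left (Nat.le_add_right _ _)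
  have hU : (s.drop (P.kk N * cP N)).length = P.uLen N (tStar f N) := by rw [List.length_drop, hs]; omega
  have hlen : (boolPair (unaryEncodeNat N) (P.Dsample f N (tStar f N) [] false [] (s.take (P.kk N * cP N)) (s.drop (P.kk N * cP N)))).length =
      2 * N + 2 + P.sLen N (tStar f N) := by
    rw [length_boolPair, show (unaryEncodeNat N).length = N from unary_decode_encode_nat N,
      length_Dsample hlp (by simp) (fun h => absurd h Bool.false_ne_true) hpcs hU]
  rw [outputPMF_true_toReal, LenPres.pr_eq_uniformAvg_ite A id _ {true} (k := P.κA A N (tStar f N)) (by rw [id, hlen, κA])]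
  refine uniformAvg_congr fun rA _ => ?_
  rw [ite_mem_singleton_eq_ind, runD, List.take_append_of_le_length (by rw [hs]; omega), List.drop_append_of_le_length (by rw [hs]; omega),
    List.take_left' hU, List.drop_left' hs]

/-- **`Pr[A(1^N, ℰ_N) = 1] = Pr[A(ℰ^{(ε)}) = 1]`.** [folklore] -/
theorem acceptPMF_Eens (hlp : IsLengthPreserving f) (A : RandAlg (List Bool) Bool) (N : ℕ) :
    (acceptPMF A N (P.Eens f N) true).toReal = P.accE f A N (tStar f N) [] := by
  rw [Eens, acceptPMF_map_uniformBits_toReal, accE, eTot]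
  conv_rhs => rw [uniformAvg_append]
  refine uniformAvg_congr fun s hs => ?_
  have hpcs : (s.take (P.kk N * cP N)).length = P.kk N * cP N := by rw [List.length_take, hs]; exact min_eq_left (by omega)
  have hU : ((s.drop (P.kk N * cP N)).take (P.uLen N (tStar f N))).length = P.uLen N (tStar f N) := by
    rw [List.length_take, List.length_drop, hs]; exact min_eq_left (by omega)
  have hZ : (s.drop (P.kk N * cP N + P.uLen N (tStar f N))).length = P.mlen N (tStar f N) := by rw [List.length_drop, hs]; omega
  have hlen : (boolPair (unaryEncodeNat N) (P.Esample f N [] false [] (s.take (P.kk N * cP N)) ((s.drop (P.kk N * cP N)).take (P.uLen N (tStar f N)))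
      (s.drop (P.kk N * cP N + P.uLen N (tStar f N))))).length = 2 * N + 2 + P.sLen N (tStar f N) := by
    rw [length_boolPair, show (unaryEncodeNat N).length = N from unary_decode_encode_nat N,
      length_Esample hlp (by simp) (fun h => absurd h Bool.false_ne_true) hpcs hU hZ]
  rw [outputPMF_true_toReal, LenPres.pr_eq_uniformAvg_ite A id _ {true} (k := P.κA A N (tStar f N)) (by rw [id, hlen, κA])]
  refine uniformAvg_congr fun rA _ => ?_
  have e1 : (s ++ rA).take (P.kk N * cP N) = s.take (P.kk N * cP N) := List.take_append_of_le_length (by rw [hs]; omega)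
  have e2 : ((s ++ rA).drop (P.kk N * cP N)).take (P.uLen N (tStar f N)) = (s.drop (P.kk N * cP N)).take (P.uLen N (tStar f N)) := by
    rw [List.drop_append_of_le_length (by rw [hs]; omega), List.take_append_of_le_length (by rw [List.length_drop, hs]; omega)]
  have e3 : ((s ++ rA).drop (P.kk N * cP N + P.uLen N (tStar f N))).take (P.mlen N (tStar f N)) = s.drop (P.kk N * cP N + P.uLen N (tStar f N)) := by
    rw [List.drop_append_of_le_length (by rw [hs]; omega), List.take_append_of_le_length (by rw [List.length_drop, hs]; omega),
      List.take_of_length_le (by rw [List.length_drop, hs]; omega)]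
  have e4 : (s ++ rA).drop (P.kk N * cP N + P.uLen N (tStar f N) + P.mlen N (tStar f N)) = rA := List.drop_left' hs
  rw [ite_mem_singleton_eq_ind, runE, e1, e2, e3, e4]

/-- **The output flip** `¬A`. [folklore] -/
def flipAlg (A : RandAlg (List Bool) Bool) : RandAlg (List Bool) Bool where
  run z r := !(A.run z r)
  coinLen := A.coinLen

/-- The flip of a PPT distinguisher is PPT. [folklore] -/
theorem isPPT_flipAlg (hA : IsPPT A encodeBool) : IsPPT (flipAlg A) encodeBool := by
  refine ⟨?_, hA.2⟩
  have hnot : PolyTimeComputable encodeBool encodeBool (fun b : Bool => !b) :=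
    PolyTimeComputable.of_encode_eq (ea := id) (eb := id) (f := Brick.notFn fun w => w) (ea' := encodeBool) (eb' := encodeBool)
      (f' := fun b : Bool => !b) encodeBool (fun _ => rfl) (fun b => Brick.notFn_apply (c := fun w => w) (z := encodeBool b) (b := b) rfl)
      (Brick.notFn_mem_FP GGM.id_mem_FP')
  exact PolyTimeComputable.comp_holds hnot hA.1

/-- The flip negates the gap. [folklore] -/
theorem delta_flipAlg (N t : ℕ) (τ : List (List Bool × Bool)) : P.delta f (flipAlg A) N t τ = -P.delta f A N t τ := by
  have hD : P.accD f (flipAlg A) N t τ = 1 - P.accD f A N t τ := by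
    rw [accD, accD, show P.dTot (flipAlg A) N t = P.dTot A N t from rfl]
    rw [show (fun r => Greedy.ind (P.runD f (flipAlg A) N t τ false [] r = true)) = fun r => 1 - Greedy.ind (P.runD f A N t τ false [] r = true) from
      funext fun r => by rw [← Greedy.ind_not]; unfold runD flipAlg; simp]
    rw [uniformAvg_sub_fun, uniformAvg_const]
  have hE : P.accE f (flipAlg A) N t τ = 1 - P.accE f A N t τ := by
    rw [accE, accE, show P.eTot (flipAlg A) N t = P.eTot A N t from rfl]
    rw [show (fun r => Greedy.ind (P.runE f (flipAlg A) N t τ false [] r = true)) = fun r => 1 - Greedy.ind (P.runE f A N t τ false [] r = true) from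
      funext fun r => by rw [← Greedy.ind_not]; unfold runE flipAlg; simp]
    rw [uniformAvg_sub_fun, uniformAvg_const]
  rw [delta, delta, hD, hE]; ring

/-! ### The coin budget of the machine -/

section Budget

variable (kcP NsP τnP mB : Polynomial ℕ)

/-- A polynomial bound on `cP`. [folklore] -/
noncomputable def cPP : Polynomial ℕ := X + R0 + X ^ 2 + X

/-- A polynomial bound on `2k·cP + 2·uLen + m`. [folklore] -/
noncomputable def αP : Polynomial ℕ := 2 * kcP ^ 3 * cPP + 2 * (kcP ^ 3 * X + 1) * mB + mB

/-- **The block of the coin code**: exceeds `t*`, and `(κ + 1)·Kb` covers `k` stages and one extra sample pair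
whatever `A`'s coin count `κ`. [folklore] -/
noncomputable def Kb : Polynomial ℕ :=
  kcP ^ 3 * (X + 1) + kcP ^ 3 * τnP * X + (kcP ^ 3 * τnP * NsP + 1) * αP kcP mB + 1 + 2 * (kcP ^ 3 * τnP * NsP + 1) + (2 * X + 4)

variable {kcP NsP τnP mB}

/-- `cP N ≤ cPP(N)`. [folklore] -/
theorem cP_le_cPP (N : ℕ) : cP N ≤ (cPP).eval N := by
  have hk : kL N ≤ N := Nat.log_le_self 2 N
  simp only [cPP, eval_add, eval_X, eval_pow, R0_eval]
  unfold cP; nlinarith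

/-- `t*(N) < Kb(N)`. [folklore] -/
theorem tStar_lt_Kb (f : List Bool → List Bool) (N : ℕ) : tStar f N < (Kb kcP NsP τnP mB).eval N := by
  have h1 := tStar_le f N
  have h2 := two_pow_bLen_le N
  have h3 : 2 * N + 4 ≤ (Kb kcP NsP τnP mB).eval N := by simp only [Kb, eval_add, eval_mul, eval_X, eval_ofNat]; omega
  omega

/-- **Enough coins**: `j·cS + cSamp + 1 ≤ code` for `j ≤ k` (under the parameter spec and the bound `mB` on `m`). [folklore] -/
theorem need_le_code {mlenF : List Bool → List Bool} (hS : ProgSpec P kcP mlenF) {N : ℕ} (hm : P.mlen N (tStar f N) ≤ mB.eval N)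
    {j : ℕ} (hj : j ≤ P.kk N) :
    j * (P.QM f A NsP τnP N (tStar f N)).cS + P.cSamp A N (tStar f N) + 1 ≤
      code ((Kb kcP NsP τnP mB).eval N) (P.kk N) (tStar f N) j (P.κA A N (tStar f N)) := by
  -- the `κ`-free part of one sample pair
  set αv := 2 * (P.kk N * cP N) + 2 * P.uLen N (tStar f N) + P.mlen N (tStar f N) with hαv
  have hkk3 : P.kk N = kcP.eval N ^ 3 := by rw [kk, hS.kc_eq]
  have hcS : (P.QM f A NsP τnP N (tStar f N)).cS = bLen N + τnP.eval N * (N + NsP.eval N * P.cSamp A N (tStar f N)) := rfl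
  have hcSamp : P.cSamp A N (tStar f N) = αv + 2 * P.κA A N (tStar f N) := by rw [hαv, cSamp, dTot, eTot]; ring
  have hαP : αv ≤ (αP kcP mB).eval N := by
    have h1 := cP_le_cPP N
    have h2 : P.uLen N (tStar f N) ≤ (P.kk N * N + 1) * mB.eval N := by
      rw [uLen]
      exact Nat.mul_le_mul (Nat.succ_le_succ (Nat.mul_le_mul_left _ (Nat.log_le_self 2 N))) hm
    simp only [αP, eval_add, eval_mul, eval_pow, eval_X, eval_ofNat, eval_one, ← hkk3]
    rw [hαv]
    have h3 : P.kk N * cP N ≤ P.kk N * (cPP).eval N := Nat.mul_le_mul_left _ h1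
    nlinarith
  have hb : bLen N ≤ N + 1 := bLen_le_succ N
  -- the two brackets
  have hK : (Kb kcP NsP τnP mB).eval N = P.kk N * (N + 1) + P.kk N * τnP.eval N * N + (P.kk N * τnP.eval N * NsP.eval N + 1) * (αP kcP mB).eval N + 1 +
      2 * (P.kk N * τnP.eval N * NsP.eval N + 1) + (2 * N + 4) := by
    simp only [Kb, eval_add, eval_mul, eval_pow, eval_X, eval_ofNat, eval_one, ← hkk3]
  have h1 : P.kk N * bLen N + P.kk N * τnP.eval N * N + (P.kk N * τnP.eval N * NsP.eval N + 1) * αv + 1 ≤ (Kb kcP NsP τnP mB).eval N := by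
    rw [hK]
    have : (P.kk N * τnP.eval N * NsP.eval N + 1) * αv ≤ (P.kk N * τnP.eval N * NsP.eval N + 1) * (αP kcP mB).eval N := Nat.mul_le_mul_left _ hαP
    have : P.kk N * bLen N ≤ P.kk N * (N + 1) := Nat.mul_le_mul_left _ hb
    omega
  have h2 : 2 * (P.kk N * τnP.eval N * NsP.eval N + 1) ≤ (Kb kcP NsP τnP mB).eval N := by rw [hK]; omega
  have hneed : j * (P.QM f A NsP τnP N (tStar f N)).cS + P.cSamp A N (tStar f N) + 1 ≤
      (P.kk N * bLen N + P.kk N * τnP.eval N * N + (P.kk N * τnP.eval N * NsP.eval N + 1) * αv + 1) +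
        P.κA A N (tStar f N) * (2 * (P.kk N * τnP.eval N * NsP.eval N + 1)) := by
    have hjcS : j * (P.QM f A NsP τnP N (tStar f N)).cS ≤ P.kk N * (P.QM f A NsP τnP N (tStar f N)).cS := Nat.mul_le_mul_right _ hj
    have heq : P.kk N * (P.QM f A NsP τnP N (tStar f N)).cS + P.cSamp A N (tStar f N) + 1 =
        (P.kk N * bLen N + P.kk N * τnP.eval N * N + (P.kk N * τnP.eval N * NsP.eval N + 1) * αv + 1) +
          P.κA A N (tStar f N) * (2 * (P.kk N * τnP.eval N * NsP.eval N + 1)) := by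
      rw [hcS, hcSamp]; ring
    omega
  refine hneed.trans ?_
  calc (P.kk N * bLen N + P.kk N * τnP.eval N * N + (P.kk N * τnP.eval N * NsP.eval N + 1) * αv + 1) +
        P.κA A N (tStar f N) * (2 * (P.kk N * τnP.eval N * NsP.eval N + 1))
      ≤ (Kb kcP NsP τnP mB).eval N + P.κA A N (tStar f N) * (Kb kcP NsP τnP mB).eval N := Nat.add_le_add h1 (Nat.mul_le_mul_left _ h2)
    _ = (P.κA A N (tStar f N) + 1) * (Kb kcP NsP τnP mB).eval N := by ring
    _ ≤ ((P.κA A N (tStar f N) + 1) * (P.kk N + 1) + j) * (Kb kcP NsP τnP mB).eval N + tStar f N := by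
      have : (P.κA A N (tStar f N) + 1) ≤ (P.κA A N (tStar f N) + 1) * (P.kk N + 1) + j := by nlinarith
      have := Nat.mul_le_mul_right ((Kb kcP NsP τnP mB).eval N) this
      omega
    _ = code ((Kb kcP NsP τnP mB).eval N) (P.kk N) (tStar f N) j (P.κA A N (tStar f N)) := rfl

/-- **Room for the template in one stage**: `2N + 2 ≤ cS` (`k, Ns, τ ≥ 1`). [folklore] -/
theorem two_mul_add_two_le_cS {N t : ℕ} (hk : 1 ≤ P.kc N) (hNs : 1 ≤ NsP.eval N) (hτn : 1 ≤ τnP.eval N) :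
    2 * N + 2 ≤ (P.QM f A NsP τnP N t).cS := by
  have hkk : 1 ≤ P.kk N := Nat.one_le_pow _ _ hk
  have hcP : N + 6 ≤ cP N := by unfold cP rlen; nlinarith
  have hc : 2 * (N + 6) ≤ P.cSamp A N t := by
    have : cP N ≤ P.kk N * cP N := Nat.le_mul_of_pos_left _ hkk
    unfold cSamp dTot eTot; omega
  show 2 * N + 2 ≤ bLen N + τnP.eval N * (N + NsP.eval N * P.cSamp A N t)
  have h1 : P.cSamp A N t ≤ NsP.eval N * P.cSamp A N t := Nat.le_mul_of_pos_left _ hNs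
  have h2 : N + NsP.eval N * P.cSamp A N t ≤ τnP.eval N * (N + NsP.eval N * P.cSamp A N t) := Nat.le_mul_of_pos_left _ hτn
  omega

end Budget

/-! ### The budget read off the input length -/

/-- The input length of level `N`: `|⟨1^N, atom⟩| = 2N + 2 + La N`. [folklore] -/
def inLen (N : ℕ) : ℕ := 2 * N + 2 + La N

/-- `La` is monotone. [folklore] -/
theorem La_mono : Monotone La := by
  refine monotone_nat_of_le_succ fun N => ?_
  have hb := bLen_succ_le N
  have hb' : bLen N ≤ bLen (N + 1) := by unfold bLen; have := Nat.log_mono_right (b := 2) (Nat.le_add_right N 1); omega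
  have hk : kL N ≤ kL (N + 1) := Nat.log_mono_right (Nat.le_add_right N 1)
  have hr : rlen N ≤ rlen (N + 1) := by unfold rlen; nlinarith
  have hkN : kL N * N ≤ kL (N + 1) * (N + 1) := Nat.mul_le_mul hk (Nat.le_add_right N 1)
  unfold La Lg hLen eLen ibLen nLen at *
  omega

/-- The input length is strictly increasing in the level. [folklore] -/
theorem inLen_strictMono : StrictMono inLen := by
  refine strictMono_nat_of_lt_succ fun N => ?_
  have := La_mono (show N ≤ N + 1 by omega)
  unfold inLen; omega

/-- **The level of an input length** (the largest `N` with `inLen N ≤ ℓ`). [folklore] -/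
def lvlN (ℓ : ℕ) : ℕ := Nat.findGreatest (fun N => inLen N ≤ ℓ) ℓ

/-- `lvlN (inLen N) = N`. [folklore] -/
theorem lvlN_inLen (N : ℕ) : lvlN (inLen N) = N := by
  unfold lvlN
  rw [Nat.findGreatest_eq_iff]
  refine ⟨by unfold inLen; omega, fun _ => le_rfl, fun n hNn _ h => ?_⟩
  exact absurd h (not_le.2 (inLen_strictMono hNn))

/-- `lvlN ℓ ≤ ℓ`. [folklore] -/
theorem lvlN_le (ℓ : ℕ) : lvlN ℓ ≤ ℓ := Nat.findGreatest_le _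

section Cl

variable (P f A) (kcP NsP τnP mB : Polynomial ℕ) (jA : ℕ → ℕ)

/-- **The coin budget of `M^{(A)}`** as a function of the input length: the code of level `lvlN ℓ`
carrying `t*`, the stage index `j_A` and `A`'s coin count. [cite: HastadImpagliazzoLevinLuby1999, Def. 3.1.1 (mildly non-uniform adversary) with Lemma 6.3.2] -/
noncomputable def clM (ℓ : ℕ) : ℕ :=
  code ((Kb kcP NsP τnP mB).eval (lvlN ℓ)) (P.kk (lvlN ℓ)) (tStar f (lvlN ℓ)) (jA (lvlN ℓ)) (P.κA A (lvlN ℓ) (tStar f (lvlN ℓ)))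

variable {P f A kcP NsP τnP mB jA}

/-- On the inputs of level `N` the budget is the code of level `N`. [folklore] -/
theorem clM_inLen (N : ℕ) :
    clM P f A kcP NsP τnP mB jA (inLen N) = code ((Kb kcP NsP τnP mB).eval N) (P.kk N) (tStar f N) (jA N) (P.κA A N (tStar f N)) := by
  rw [clM, lvlN_inLen]

/-- **The budget is polynomially bounded** (PPT `A`, `j_A ≤ k`, `m ≤ mB`, `kc = kcP`). [folklore] -/
theorem clM_le {mlenF : List Bool → List Bool} (hS : ProgSpec P kcP mlenF) {qA : Polynomial ℕ} (hqA : ∀ ℓ, A.coinLen ℓ ≤ qA.eval ℓ)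
    (hjA : ∀ N, jA N ≤ P.kk N) (hm : ∀ N, P.mlen N (tStar f N) ≤ mB.eval N) :
    ∃ q : Polynomial ℕ, ∀ ℓ, clM P f A kcP NsP τnP mB jA ℓ ≤ q.eval ℓ := by
  -- a polynomial bound on the sample length `sLen`
  set sP : Polynomial ℕ := mB + kcP ^ 3 * (LgP + X * X) + (kcP ^ 3 * X + 1) * mB with hsP
  have hsLen : ∀ N, P.sLen N (tStar f N) ≤ sP.eval N := by
    intro N
    have hk : kL N ≤ N := Nat.log_le_self 2 N
    have hkk : P.kk N = kcP.eval N ^ 3 := by rw [kk, hS.kc_eq]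
    have h1 : pubLen N ≤ LgP.eval N + N * N := by unfold pubLen; have := Lg_le_LgP N; nlinarith
    have h2 : P.uLen N (tStar f N) ≤ (P.kk N * N + 1) * mB.eval N := by
      rw [uLen]; exact Nat.mul_le_mul (Nat.succ_le_succ (Nat.mul_le_mul_left _ hk)) (hm N)
    simp only [hsP, eval_add, eval_mul, eval_pow, eval_X, eval_one, ← hkk]
    have h3 : P.kk N * pubLen N ≤ P.kk N * (LgP.eval N + N * N) := Nat.mul_le_mul_left _ h1
    unfold sLen
    have := hm N
    omega
  refine ⟨((qA.comp (C 2 * X + C 2 + sP) + 1) * (kcP ^ 3 + 1) + kcP ^ 3) * Kb kcP NsP τnP mB + (C 2 * X + C 2), fun ℓ => ?_⟩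
  set N := lvlN ℓ with hN
  have hNℓ : N ≤ ℓ := lvlN_le ℓ
  have hkk : P.kk N = kcP.eval N ^ 3 := by rw [kk, hS.kc_eq]
  have hκ : P.κA A N (tStar f N) ≤ (qA.comp (C 2 * X + C 2 + sP)).eval ℓ := by
    unfold κA
    refine (hqA _).trans ?_
    simp only [eval_comp, eval_add, eval_mul, eval_C, eval_X]
    exact TM2Iter.eval_mono _ (by have := hsLen N; have := TM2Iter.eval_mono sP hNℓ; omega)
  have ht : tStar f N ≤ 2 * ℓ + 2 := (tStar_le f N).trans ((two_pow_bLen_le N).trans (by omega))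
  have hj := hjA N
  have hKb : (Kb kcP NsP τnP mB).eval N ≤ (Kb kcP NsP τnP mB).eval ℓ := TM2Iter.eval_mono _ hNℓ
  have hkcP : kcP.eval N ^ 3 ≤ kcP.eval ℓ ^ 3 := Nat.pow_le_pow_left (TM2Iter.eval_mono _ hNℓ) 3
  show code ((Kb kcP NsP τnP mB).eval N) (P.kk N) (tStar f N) (jA N) (P.κA A N (tStar f N)) ≤ _
  rw [code, hkk]
  simp only [eval_add, eval_mul, eval_pow, eval_one, eval_C, eval_X]
  rw [hkk] at hj
  have h1 : (P.κA A N (tStar f N) + 1) * (kcP.eval N ^ 3 + 1) + jA N ≤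
      ((qA.comp (C 2 * X + C 2 + sP)).eval ℓ + 1) * (kcP.eval ℓ ^ 3 + 1) + kcP.eval ℓ ^ 3 :=
    Nat.add_le_add (Nat.mul_le_mul (Nat.succ_le_succ hκ) (Nat.succ_le_succ hkcP)) (hj.trans hkcP)
  have h2 := Nat.mul_le_mul h1 hKb
  omega

end Cl

/-! ### The parameters for a gap exponent `c₀` and their asymptotics -/

section Asymptotics

variable (kcP : Polynomial ℕ) (c₀ : ℕ)

/-- **`τ(N)`** (candidates per stage): `3(2N+2)·16k·N^{c₀}·(N+1) + 1`, so that `(1 − pmin ρ/3)^{τ} ≤ e^{−(N+1)}`.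
[cite: HastadImpagliazzoLevinLuby1999, Lemma 6.3.2 (proof: τ = 64n²/ρ)] -/
noncomputable def τnQ : Polynomial ℕ := 3 * (2 * X + 2) * 16 * kcP ^ 3 * X ^ c₀ * (X + 1) + 1

/-- **`Ns(N)`** (sample pairs per estimate): `512 k² N^{2c₀} (N+1) + 1`, so that `e^{−Ns ρ²/2} ≤ e^{−(N+1)}`.
[cite: HastadImpagliazzoLevinLuby1999, Lemma 6.3.2 (proof: "sampling O(n/ρ²) times")] -/
noncomputable def NsQ : Polynomial ℕ := 512 * kcP ^ 6 * X ^ (2 * c₀) * (X + 1) + 1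

/-- **`ρ(N) = 1/(16 k N^{c₀})`** (`k = kc³`). [cite: HastadImpagliazzoLevinLuby1999, Lemma 6.3.2 (proof: ρ = δₙ/(16kₙ))] -/
noncomputable def ρQ (N : ℕ) : ℝ := 1 / (16 * ((kcP.eval N : ℕ) : ℝ) ^ 3 * (N : ℝ) ^ c₀)

variable {kcP c₀}

/-- `0 ≤ ρ(N) ≤ 1`. [folklore] -/
theorem ρQ_mem (hkc : ∀ N, N ≤ kcP.eval N) (N : ℕ) : 0 ≤ ρQ kcP c₀ N ∧ ρQ kcP c₀ N ≤ 1 := by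
  unfold ρQ
  refine ⟨by positivity, ?_⟩
  rcases Nat.eq_zero_or_pos N with rfl | hN
  · rcases Nat.eq_zero_or_pos c₀ with rfl | hc
    · rcases Nat.eq_zero_or_pos (kcP.eval 0) with h0 | h0
      · rw [h0]; norm_num
      · have : (1 : ℝ) ≤ ((kcP.eval 0 : ℕ) : ℝ) ^ 3 := by exact_mod_cast Nat.one_le_pow _ _ h0
        rw [div_le_one (by positivity)]; push_cast; nlinarith
    · simp [zero_pow hc.ne']
  · have hk : (1 : ℝ) ≤ ((kcP.eval N : ℕ) : ℝ) ^ 3 := by exact_mod_cast Nat.one_le_pow _ _ (le_trans hN (hkc N))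
    have hNc : (1 : ℝ) ≤ (N : ℝ) ^ c₀ := one_le_pow₀ (by exact_mod_cast hN)
    rw [div_le_one (by positivity)]
    nlinarith

/-- `(1 − x)^n ≤ e^{−xn}` for `x ≤ 1`. [folklore] -/
private theorem one_sub_pow_le_exp {x : ℝ} (hx1 : x ≤ 1) (n : ℕ) : (1 - x) ^ n ≤ exp (-(x * n)) := by
  calc (1 - x) ^ n ≤ (exp (-x)) ^ n := pow_le_pow_left₀ (by linarith) (Real.one_sub_le_exp_neg x) n
    _ = exp (-(x * n)) := by rw [← Real.exp_nat_mul]; ring_nf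

/-- The real-variable core of `eventually_kk_mul_ρ'_le`. [folklore] -/
private theorem kk_mul_ρ'_core {K3 Nc τn Ns pmin Nr ρ : ℝ} (hK3 : 0 < K3) (hNc : 0 < Nc) (hpmin0 : 0 < pmin) (hpmin1 : pmin ≤ 1)
    (hNr : 0 ≤ Nr) (hpmin_ge : 1 / (2 * Nr + 2) ≤ pmin) (hρ : ρ = 1 / (16 * K3 * Nc)) (hρ1 : ρ ≤ 1)
    (hτn : 3 * (2 * Nr + 2) * 16 * K3 * Nc * (Nr + 1) ≤ τn) (hNs : 512 * K3 ^ 2 * Nc ^ 2 * (Nr + 1) ≤ Ns)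
    (hQ : 16 * Nc * (2 * K3 + 4 * K3 * τn) * exp (-Nr) < 1) {n : ℕ} (hn : (n : ℝ) = τn) :
    K3 * (3 * ρ + 2 * ((1 - pmin * ρ / 3) ^ n + τn * (2 * exp (-(Ns * ρ ^ 2 / 2))))) ≤ 1 / (4 * Nc) := by
  have hρpos : 0 < ρ := by rw [hρ]; positivity
  have hτn_nn : 0 ≤ τn := le_trans (by positivity) hτn
  -- term A
  have hA : K3 * (3 * ρ) = 3 / (16 * Nc) := by rw [hρ]; field_simp
  -- term B
  have hx1 : pmin * ρ / 3 ≤ 1 := by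
    have : pmin * ρ ≤ 1 * 1 := mul_le_mul hpmin1 hρ1 hρpos.le zero_le_one
    linarith
  have hB : (1 - pmin * ρ / 3) ^ n ≤ exp (-(Nr + 1)) := by
    refine (one_sub_pow_le_exp hx1 _).trans ?_
    rw [Real.exp_le_exp, neg_le_neg_iff, hn]
    have h1 : Nr + 1 = 1 / (2 * Nr + 2) * (1 / (16 * K3 * Nc)) / 3 * (3 * (2 * Nr + 2) * 16 * K3 * Nc * (Nr + 1)) := by
      field_simp
    rw [h1, ← hρ]
    have h2 : 1 / (2 * Nr + 2) * ρ / 3 ≤ pmin * ρ / 3 := by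
      have := mul_le_mul_of_nonneg_right hpmin_ge hρpos.le; linarith
    calc 1 / (2 * Nr + 2) * ρ / 3 * (3 * (2 * Nr + 2) * 16 * K3 * Nc * (Nr + 1))
        ≤ pmin * ρ / 3 * (3 * (2 * Nr + 2) * 16 * K3 * Nc * (Nr + 1)) := mul_le_mul_of_nonneg_right h2 (by positivity)
      _ ≤ pmin * ρ / 3 * τn := mul_le_mul_of_nonneg_left hτn (by positivity)
  -- term C
  have hC : exp (-(Ns * ρ ^ 2 / 2)) ≤ exp (-(Nr + 1)) := by
    rw [Real.exp_le_exp, neg_le_neg_iff]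
    have h1 : Nr + 1 = 512 * K3 ^ 2 * Nc ^ 2 * (Nr + 1) * (1 / (16 * K3 * Nc)) ^ 2 / 2 := by field_simp; ring
    rw [h1, ← hρ]
    exact div_le_div_of_nonneg_right (mul_le_mul_of_nonneg_right hNs (sq_nonneg _)) (by norm_num)
  have hexp1 : exp (-(Nr + 1)) = exp (-Nr) * exp (-1) := by rw [← Real.exp_add]; ring_nf
  have he1 : exp (-1 : ℝ) ≤ 1 := by rw [Real.exp_le_one_iff]; norm_num
  have hX : K3 * (1 - pmin * ρ / 3) ^ n ≤ K3 * exp (-(Nr + 1)) := mul_le_mul_of_nonneg_left hB hK3.le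
  have hY : K3 * τn * exp (-(Ns * ρ ^ 2 / 2)) ≤ K3 * τn * exp (-(Nr + 1)) := mul_le_mul_of_nonneg_left hC (by positivity)
  have hfac : 0 ≤ (2 * K3 + 4 * K3 * τn) * exp (-Nr) := by positivity
  have hBC : K3 * (2 * ((1 - pmin * ρ / 3) ^ n + τn * (2 * exp (-(Ns * ρ ^ 2 / 2))))) ≤ 1 / (16 * Nc) := by
    calc K3 * (2 * ((1 - pmin * ρ / 3) ^ n + τn * (2 * exp (-(Ns * ρ ^ 2 / 2)))))
        = 2 * (K3 * (1 - pmin * ρ / 3) ^ n) + 4 * (K3 * τn * exp (-(Ns * ρ ^ 2 / 2))) := by ring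
      _ ≤ 2 * (K3 * exp (-(Nr + 1))) + 4 * (K3 * τn * exp (-(Nr + 1))) := by linarith
      _ = (2 * K3 + 4 * K3 * τn) * exp (-Nr) * exp (-1) := by rw [hexp1]; ring
      _ ≤ (2 * K3 + 4 * K3 * τn) * exp (-Nr) * 1 := mul_le_mul_of_nonneg_left he1 hfac
      _ = (16 * Nc * (2 * K3 + 4 * K3 * τn) * exp (-Nr)) / (16 * Nc) := by field_simp
      _ ≤ 1 / (16 * Nc) := div_le_div_of_nonneg_right hQ.le (by positivity)
  have htot : K3 * (3 * ρ + 2 * ((1 - pmin * ρ / 3) ^ n + τn * (2 * exp (-(Ns * ρ ^ 2 / 2))))) ≤ 3 / (16 * Nc) + 1 / (16 * Nc) := by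
    rw [mul_add, hA]; linarith
  refine htot.trans (le_of_eq ?_)
  field_simp
  ring

/-- **`k·ρ' ≤ 1/(4N^{c₀})` eventually** (`ρ' = 3ρ + 2((1 − pmin ρ/3)^{τ} + τ·2e^{−Ns ρ²/2})`, `pmin = 2^{−b(N)}`): the
two exponentially small terms lose against the polynomial factors. [folklore] -/
theorem eventually_kk_mul_ρ'_le (hkc : ∀ N, N ≤ kcP.eval N) :
    ∀ᶠ N : ℕ in atTop, (((kcP.eval N : ℕ) : ℝ) ^ 3) * (3 * ρQ kcP c₀ N + 2 * ((1 - (1 / 2 ^ bLen N) * ρQ kcP c₀ N / 3) ^ (τnQ kcP c₀).eval N +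
        (((τnQ kcP c₀).eval N : ℕ) : ℝ) * (2 * exp (-((((NsQ kcP c₀).eval N : ℕ) : ℝ) * ρQ kcP c₀ N ^ 2 / 2))))) ≤ 1 / (4 * (N : ℝ) ^ c₀) := by
  have hQ := Yao.eventually_natPoly_mul_exp_lt (C 16 * X ^ c₀ * (C 2 * kcP ^ 3 + C 4 * kcP ^ 3 * τnQ kcP c₀)) one_pos
  filter_upwards [eventually_ge_atTop 1, hQ] with N hN hQN
  have hK3pos : (0 : ℝ) < ((kcP.eval N : ℕ) : ℝ) ^ 3 := by exact_mod_cast pow_pos (le_trans hN (hkc N)) 3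
  have hNcpos : (0 : ℝ) < (N : ℝ) ^ c₀ := by exact_mod_cast pow_pos hN c₀
  obtain ⟨-, hρ1⟩ := ρQ_mem (c₀ := c₀) hkc N
  have hpmin_ge : 1 / (2 * (N : ℝ) + 2) ≤ 1 / 2 ^ bLen N := by
    refine div_le_div_of_nonneg_left zero_le_one (by positivity) ?_
    exact_mod_cast two_pow_bLen_le N
  have hpmin_le : (1 : ℝ) / 2 ^ bLen N ≤ 1 := by rw [div_le_one (by positivity)]; exact one_le_pow₀ (by norm_num)
  have hτn_ge : 3 * (2 * (N : ℝ) + 2) * 16 * ((kcP.eval N : ℕ) : ℝ) ^ 3 * (N : ℝ) ^ c₀ * (N + 1) ≤ (((τnQ kcP c₀).eval N : ℕ) : ℝ) := by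
    rw [τnQ]; simp only [eval_add, eval_mul, eval_pow, eval_X, eval_ofNat, eval_one]; push_cast; linarith
  have hNs_ge : 512 * (((kcP.eval N : ℕ) : ℝ) ^ 3) ^ 2 * ((N : ℝ) ^ c₀) ^ 2 * ((N : ℝ) + 1) ≤ (((NsQ kcP c₀).eval N : ℕ) : ℝ) := by
    rw [NsQ]; simp only [eval_add, eval_mul, eval_pow, eval_X, eval_ofNat, eval_one]; push_cast
    rw [← pow_mul, ← pow_mul, show 3 * 2 = 6 by rfl, mul_comm c₀ 2]; linarith
  have hQeval : (((C 16 * X ^ c₀ * (C 2 * kcP ^ 3 + C 4 * kcP ^ 3 * τnQ kcP c₀)).eval N : ℕ) : ℝ) =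
      16 * (N : ℝ) ^ c₀ * (2 * ((kcP.eval N : ℕ) : ℝ) ^ 3 + 4 * ((kcP.eval N : ℕ) : ℝ) ^ 3 * (((τnQ kcP c₀).eval N : ℕ) : ℝ)) := by
    simp only [eval_mul, eval_add, eval_pow, eval_C, eval_X]; push_cast; ring
  rw [hQeval, show -(1 * (N : ℝ)) = -(N : ℝ) by ring] at hQN
  exact kk_mul_ρ'_core hK3pos hNcpos (by positivity) hpmin_le (Nat.cast_nonneg N) hpmin_ge rfl hρ1 hτn_ge hNs_ge hQN rfl

/-- **`e^{−2kc} + 2^{−(N+2)} ≤ 1/(4N^{c₀})` eventually** (`kc ≥ N`). [folklore] -/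
theorem eventually_tail_le (hkc : ∀ N, N ≤ kcP.eval N) :
    ∀ᶠ N : ℕ in atTop, exp (-2 * ((kcP.eval N : ℕ) : ℝ)) + 1 / 2 ^ (N + 2) ≤ 1 / (4 * (N : ℝ) ^ c₀) := by
  have h1 := Yao.eventually_natPoly_mul_exp_lt (C 8 * X ^ c₀) one_pos
  have h2 := Yao.eventually_natPoly_mul_exp_lt (C 8 * X ^ c₀) (Real.log_pos one_lt_two)
  filter_upwards [eventually_ge_atTop 1, h1, h2] with N hN h1N h2N
  have hNcpos : (0 : ℝ) < (N : ℝ) ^ c₀ := by exact_mod_cast pow_pos hN c₀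
  have hev : (((C 8 * X ^ c₀ : Polynomial ℕ).eval N : ℕ) : ℝ) = 8 * (N : ℝ) ^ c₀ := by simp only [eval_mul, eval_C, eval_pow, eval_X]; push_cast; ring
  rw [hev] at h1N h2N
  have hexp2 : exp (-(Real.log 2 * (N : ℝ))) = 1 / 2 ^ N := by
    rw [Real.exp_neg, mul_comm, Real.exp_nat_mul, Real.exp_log two_pos, one_div]
  rw [hexp2] at h2N
  rw [show -(1 * (N : ℝ)) = -(N : ℝ) by ring] at h1N
  have ha : exp (-2 * ((kcP.eval N : ℕ) : ℝ)) ≤ exp (-(N : ℝ)) := by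
    rw [Real.exp_le_exp]; have : (N : ℝ) ≤ ((kcP.eval N : ℕ) : ℝ) := by exact_mod_cast hkc N
    linarith
  have hb : exp (-(N : ℝ)) < 1 / (8 * (N : ℝ) ^ c₀) := by rw [lt_div_iff₀ (by positivity)]; linarith
  have hc : (1 : ℝ) / 2 ^ (N + 2) = 1 / 2 ^ N / 4 := by rw [pow_add]; field_simp; ring
  have hd : (1 : ℝ) / 2 ^ N < 1 / (8 * (N : ℝ) ^ c₀) := by rw [lt_div_iff₀ (by positivity)]; linarith
  rw [hc]
  have hfin : 1 / (8 * (N : ℝ) ^ c₀) + 1 / (8 * (N : ℝ) ^ c₀) / 4 ≤ 1 / (4 * (N : ℝ) ^ c₀) := by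
    rw [show 1 / (8 * (N : ℝ) ^ c₀) + 1 / (8 * (N : ℝ) ^ c₀) / 4 = 5 / (32 * (N : ℝ) ^ c₀) by field_simp; ring,
      div_le_div_iff₀ (by positivity) (by positivity)]
    nlinarith
  linarith

end Asymptotics

/-! ### The contradiction -/

section Main

variable {kcP mB : Polynomial ℕ} {mlenF : List Bool → List Bool}

/-- A nonnegative sequence that is not negligible is at least `1/n^k` infinitely often. [cite: Goldreich2001, §1.3.5] -/
private theorem exists_frequently_ge_of_not_spd {u : ℕ → ℝ} (h0 : ∀ n, 0 ≤ u n)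
    (h : ¬ Asymptotics.SuperpolynomialDecay atTop (fun n : ℕ => (n : ℝ)) u) :
    ∃ k : ℕ, ∃ᶠ n : ℕ in atTop, 1 / (n : ℝ) ^ k ≤ u n := by
  have h' := (isNegligible_iff_eventually_lt_of_nonneg h0).not.1 h
  push Not at h'
  obtain ⟨c, hc⟩ := h'
  exact ⟨c, by simpa [Filter.not_eventually, not_lt] using hc⟩

/-- **The heart of Lemma 6.3.2**: no PPT `A₁` has gap `δ_N = Pr[A₁(𝒟_N)=1] − Pr[A₁(ℰ_N)=1] ≥ N^{−c₀}` infinitely often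
(else `M^{(A₁)}` breaks the hiding of `f'` over `𝒯̃`, Lemma 6.1.1). [cite: HastadImpagliazzoLevinLuby1999, Lemma 6.3.2 with Lemma 6.1.1] -/
theorem not_frequently_gap (hf : IsOneWay f) (hlp : IsLengthPreserving f) (hS : ProgSpec P kcP mlenF) (hkc : ∀ N, N ≤ P.kc N)
    (hm : ∀ N, P.mlen N (tStar f N) ≤ mB.eval N)
    (Hm : ∀ᶠ N : ℕ in atTop, (P.mlen N (tStar f N) : ℝ) + 2 * N + 2 ≤ kL N * (P.kk N * tStar f N / 2 ^ bLen N - (P.kc N : ℝ) ^ 2))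
    {A₁ : RandAlg (List Bool) Bool} (hA₁ : IsPPT A₁ encodeBool) {c₀ : ℕ}
    (hfr : ∃ᶠ N : ℕ in atTop, 1 / (N : ℝ) ^ c₀ ≤ P.delta f A₁ N (tStar f N) []) : False := by
  classical
  have hkcP : ∀ N, N ≤ kcP.eval N := fun N => by rw [← hS.kc_eq]; exact hkc N
  have hkk : ∀ N, P.kk N = (kcP ^ 3).eval N := hS.kk_eq
  -- the parameters
  set NsP := NsQ kcP c₀ with hNsP
  set τnP := τnQ kcP c₀ with hτnP
  set ρf := ρQ kcP c₀ with hρf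
  have hNs1 : ∀ N, 1 ≤ NsP.eval N := fun N => by rw [hNsP, NsQ, eval_add, eval_one]; exact Nat.le_add_left _ _
  have hτn1 : ∀ N, 1 ≤ τnP.eval N := fun N => by rw [hτnP, τnQ, eval_add, eval_one]; exact Nat.le_add_left _ _
  -- the good stage index
  set B : ℕ → ℕ → Prop := fun N j => 1 / (2 * (N : ℝ) ^ c₀ * P.kk N) ≤ (P.QD f A₁ NsP τnP ρf N).Ej j (P.QD f A₁ NsP τnP ρf N).ε with hB
  set jA : ℕ → ℕ := fun N => if h : ∃ j, j < P.kk N ∧ B N j then Classical.choose h else 0 with hjAdef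
  have hjA : ∀ N, jA N ≤ P.kk N := fun N => by
    simp only [hjAdef]
    split_ifs with h
    · exact (Classical.choose_spec h).1.le
    · exact Nat.zero_le _
  have hjA_good : ∀ N, (∃ j, j < P.kk N ∧ B N j) → jA N < P.kk N ∧ B N (jA N) := fun N h => by
    simp only [hjAdef, dif_pos h]
    exact Classical.choose_spec h
  -- the machine
  obtain ⟨qA, hqA⟩ := hA₁.2
  set M := mach f A₁ NsP τnP kcP mlenF (Kb kcP NsP τnP mB) (clM P f A₁ kcP NsP τnP mB jA) with hM
  have hPPT : IsPPT M encodeBool := isPPT_mach hS hf.1 hA₁ (clM_le hS hqA hjA hm)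
  have hspd := isCompIndistinguishable_gl hf hlp M hPPT
  -- the good levels
  set GOOD : ℕ → Prop := fun N => 2 ≤ N ∧ 1 / (N : ℝ) ^ c₀ ≤ P.delta f A₁ N (tStar f N) [] ∧
    (((kcP.eval N : ℕ) : ℝ) ^ 3) * (3 * ρQ kcP c₀ N + 2 * ((1 - (1 / 2 ^ bLen N) * ρQ kcP c₀ N / 3) ^ (τnQ kcP c₀).eval N +
        (((τnQ kcP c₀).eval N : ℕ) : ℝ) * (2 * exp (-((((NsQ kcP c₀).eval N : ℕ) : ℝ) * ρQ kcP c₀ N ^ 2 / 2))))) ≤ 1 / (4 * (N : ℝ) ^ c₀) ∧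
    exp (-2 * ((kcP.eval N : ℕ) : ℝ)) + 1 / 2 ^ (N + 2) ≤ 1 / (4 * (N : ℝ) ^ c₀) ∧
    (P.mlen N (tStar f N) : ℝ) + 2 * N + 2 ≤ kL N * (P.kk N * tStar f N / 2 ^ bLen N - (P.kc N : ℝ) ^ 2) with hGOOD
  have hgood : ∃ᶠ N in atTop, GOOD N := by
    refine (hfr.and_eventually ((eventually_ge_atTop 2).and ((eventually_kk_mul_ρ'_le (c₀ := c₀) hkcP).and
      ((eventually_tail_le (c₀ := c₀) hkcP).and Hm)))).mono fun N hN => ?_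
    exact ⟨hN.2.1, hN.1, hN.2.2.1, hN.2.2.2.1, hN.2.2.2.2⟩
  -- on a good level: a good stage exists …
  have hstage : ∀ N, GOOD N → ∃ j, j < P.kk N ∧ B N j := by
    rintro N ⟨hN2, hδ, hE1, hE2, hHm⟩
    have hN1 : 1 ≤ N := by omega
    have hk1 : 1 ≤ P.kc N := hN1.trans (hkc N)
    have hkkpos : 0 < P.kk N := Nat.one_le_pow _ _ hk1
    obtain ⟨hρ0, hρ1⟩ := ρQ_mem (c₀ := c₀) hkcP N
    have hlaws := laws (P := P) (f := f) (A := A₁) (NsP := NsP) (τnP := τnP) (ρf := ρf) hN2 hρ0 hρ1 (hNs1 N) (hτn1 N)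
    obtain ⟨j, hj, hbound⟩ := Greedy.Data.exists_good_stage hlaws hkkpos
    refine ⟨j, hj, ?_⟩
    show 1 / (2 * (N : ℝ) ^ c₀ * P.kk N) ≤ _
    refine le_trans ?_ hbound
    have hNcpos : (0 : ℝ) < (N : ℝ) ^ c₀ := by exact_mod_cast pow_pos hN1 c₀
    have hkkR : ((P.kk N : ℕ) : ℝ) = ((kcP.eval N : ℕ) : ℝ) ^ 3 := by rw [hkk, eval_pow]; push_cast; ring
    have hkkposR : (0 : ℝ) < P.kk N := by exact_mod_cast hkkpos
    -- the three terms of the numerator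
    have h1 : 1 / (N : ℝ) ^ c₀ ≤ (P.QD f A₁ NsP τnP ρf N).δ [] := hδ
    have h2 : (P.QD f A₁ NsP τnP ρf N).Ej (P.kk N) (P.QD f A₁ NsP τnP ρf N).δ ≤ 1 / (4 * (N : ℝ) ^ c₀) := by
      refine (Ej_delta_le (P := P) (f := f) (A := A₁) (NsP := NsP) (τnP := τnP) (ρf := ρf) hk1 hHm).trans ?_
      rw [hS.kc_eq]; exact hE2
    have h3 : (P.kk N : ℝ) * (P.QD f A₁ NsP τnP ρf N).ρ' (1 / 2 ^ bLen N) ≤ 1 / (4 * (N : ℝ) ^ c₀) := by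
      rw [hkkR]
      refine le_trans (le_of_eq ?_) hE1
      simp only [Greedy.Data.ρ', QD, QM, ηf, hNsP, hτnP, hρf]
    have hp_pos := hlaws.p_pos
    have hp_le : (P.QD f A₁ NsP τnP ρf N).p ≤ 1 := by
      rw [Greedy.Data.p, div_le_one (by positivity)]
      exact_mod_cast Greedy.Data.card_Tt_le _
    have hnum : 1 / (2 * (N : ℝ) ^ c₀) ≤ (P.QD f A₁ NsP τnP ρf N).δ [] - (P.QD f A₁ NsP τnP ρf N).Ej (P.kk N) (P.QD f A₁ NsP τnP ρf N).δ -
        P.kk N * (P.QD f A₁ NsP τnP ρf N).ρ' (1 / 2 ^ bLen N) := by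
      have e : 1 / (2 * (N : ℝ) ^ c₀) = 1 / (N : ℝ) ^ c₀ - 1 / (4 * (N : ℝ) ^ c₀) - 1 / (4 * (N : ℝ) ^ c₀) := by field_simp; ring
      rw [e]; linarith
    have hnn : (0 : ℝ) ≤ 1 / (2 * (N : ℝ) ^ c₀) := by positivity
    calc 1 / (2 * (N : ℝ) ^ c₀ * P.kk N) = 1 / (2 * (N : ℝ) ^ c₀) / P.kk N := by rw [div_div]
      _ ≤ 1 / (2 * (N : ℝ) ^ c₀) / ((P.QD f A₁ NsP τnP ρf N).p * P.kk N) :=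
          div_le_div_of_nonneg_left hnn (mul_pos hp_pos hkkposR) (by nlinarith)
      _ ≤ _ := div_le_div_of_nonneg_right hnum (mul_pos hp_pos hkkposR).le
  -- … and the machine distinguishes the atoms
  have hadv : ∀ N, GOOD N → 1 / (4 * (N : ℝ) ^ c₀ * P.kk N) ≤
      distAdvantage M (glRealEns (g f) (Tt f) rlen 1) (glIdealEns (g f) (Tt f) rlen 1) N := by
    intro N hG
    obtain ⟨hjlt, hjB⟩ := hjA_good N (hstage N hG)
    obtain ⟨hN2, -, -, -, -⟩ := hG
    have hN1 : 1 ≤ N := by omega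
    have hk1 : 1 ≤ P.kc N := hN1.trans (hkc N)
    set L := code ((Kb kcP NsP τnP mB).eval N) (P.kk N) (tStar f N) (jA N) (P.κA A₁ N (tStar f N)) with hL
    have hcl : M.coinLen (2 * N + 2 + La N) = L := clM_inLen (P := P) (f := f) (A := A₁) (kcP := kcP) (NsP := NsP) (τnP := τnP) (mB := mB) (jA := jA) N
    have hneed := need_le_code (P := P) (f := f) (A := A₁) (NsP := NsP) (τnP := τnP) hS (hm N) (hjA N)
    have hLb : jA N * (P.QM f A₁ NsP τnP N (tStar f N)).cS + P.dTot A₁ N (tStar f N) + P.eTot A₁ N (tStar f N) + 1 ≤ L := by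
      rw [hL]; unfold cSamp at hneed; omega
    have hrun : ∀ z R : List Bool, z.length = La N → R.length = L → M.run (boolPair (unaryEncodeNat N) z) R = P.outM f A₁ NsP τnP N (tStar f N) (jA N) z R :=
      fun z R hz hR => mach_run hS hlp hk1 (hτn1 N) (two_mul_add_two_le_cS hk1 (hNs1 N) (hτn1 N)) (tStar_lt_Kb f N) (hjA N) hz
        (by rw [hR]) (by rw [hR, hL]; exact hneed) _
    have hid := prR_sub_prI (P := P) (A := A₁) (NsP := NsP) (τnP := τnP) (ρf := ρf) hlp M hcl (hτn1 N) hjlt hLb rfl hrun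
    rw [distAdvantage, hid, abs_of_nonneg (by
      have : (0 : ℝ) ≤ 1 / (2 * (N : ℝ) ^ c₀ * P.kk N) := by positivity
      have hb : 1 / (2 * (N : ℝ) ^ c₀ * P.kk N) ≤ (P.QD f A₁ NsP τnP ρf N).Ej (jA N) (P.QD f A₁ NsP τnP ρf N).ε := hjB
      linarith)]
    have hb : 1 / (2 * (N : ℝ) ^ c₀ * P.kk N) ≤ (P.QD f A₁ NsP τnP ρf N).Ej (jA N) (P.QD f A₁ NsP τnP ρf N).ε := hjB
    have hkkpos : (0 : ℝ) < P.kk N := by exact_mod_cast Nat.one_le_pow _ _ hk1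
    have hNc : (0 : ℝ) < (N : ℝ) ^ c₀ := by positivity
    have e : 1 / (4 * (N : ℝ) ^ c₀ * P.kk N) = 1 / (2 * (N : ℝ) ^ c₀ * P.kk N) / 2 := by
      field_simp; ring
    rw [e]; linarith
  -- the polynomial `4 N^{c₀} k(N)` and the negligibility of the advantage
  set d := (kcP ^ (3 : ℕ)).natDegree with hd
  set Cst := (kcP ^ (3 : ℕ)).eval 1 with hCst
  have hCst : 1 ≤ Cst := by rw [hCst, eval_pow]; exact Nat.one_le_pow _ _ (hkcP 1)
  have hkk_le : ∀ N, 1 ≤ N → (P.kk N : ℝ) ≤ Cst * (N : ℝ) ^ d := fun N hN => by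
    have h := natPoly_eval_le_eval_one_mul_pow (kcP ^ (3 : ℕ)) hN
    rw [← hkk N] at h
    exact_mod_cast h
  have hev : ∀ᶠ N : ℕ in atTop, distAdvantage M (glRealEns (g f) (Tt f) rlen 1) (glIdealEns (g f) (Tt f) rlen 1) N <
      1 / (4 * Cst * (N : ℝ) ^ (c₀ + d)) := by
    have ht := hspd (c₀ + d)
    have hpos : (0 : ℝ) < 1 / (4 * Cst) := by positivity
    filter_upwards [(tendsto_order.1 ht).2 _ hpos, eventually_ge_atTop 1] with N hN hN1
    have hNpos : (0 : ℝ) < (N : ℝ) ^ (c₀ + d) := by positivity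
    rw [lt_div_iff₀ (by positivity)]
    calc distAdvantage M (glRealEns (g f) (Tt f) rlen 1) (glIdealEns (g f) (Tt f) rlen 1) N * (4 * Cst * (N : ℝ) ^ (c₀ + d))
        = (N : ℝ) ^ (c₀ + d) * distAdvantage M (glRealEns (g f) (Tt f) rlen 1) (glIdealEns (g f) (Tt f) rlen 1) N * (4 * Cst) := by ring
      _ < 1 / (4 * Cst) * (4 * Cst) := mul_lt_mul_of_pos_right hN (by positivity)
      _ = 1 := by field_simp
  obtain ⟨N, hG, hlt⟩ := (hgood.and_eventually hev).exists
  have hN1 : 1 ≤ N := by obtain ⟨hN2, -⟩ := hG; omega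
  have h1 := hadv N hG
  have hNc : (0 : ℝ) < (N : ℝ) ^ c₀ := by positivity
  have hkkpos : (0 : ℝ) < P.kk N := by exact_mod_cast Nat.one_le_pow _ _ (hN1.trans (hkc N))
  have h2 : 1 / (4 * Cst * (N : ℝ) ^ (c₀ + d)) ≤ 1 / (4 * (N : ℝ) ^ c₀ * P.kk N) := by
    refine div_le_div_of_nonneg_left zero_le_one (by positivity) ?_
    rw [pow_add]
    have := hkk_le N hN1
    nlinarith
  linarith

/-- **HILL Lemma 6.3.2 with Lemma 6.1.1: `𝒟 ≈_c ℰ`.** For a one-way, length-preserving `f` and polynomial parameters with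
`kc(N) ≥ N` and output length `m(N) ≤ mB(N)` satisfying eventually `m + 2N + 2 ≤ K·(k·t*/2^b − kc²)` (HILL's choice
`mₙ = kₙpₙ − 2kₙ^{2/3}`), the samplers `𝒟_N` and `ℰ_N` are computationally indistinguishable.
[cite: HastadImpagliazzoLevinLuby1999, Lemma 6.3.2 (with Lemma 6.1.1 and §6.3, last paragraph: the advice p̃ₙ)] -/
theorem isCompIndistinguishable_DE (hf : IsOneWay f) (hlp : IsLengthPreserving f) (hS : ProgSpec P kcP mlenF) (hkc : ∀ N, N ≤ P.kc N)
    (hm : ∀ N, P.mlen N (tStar f N) ≤ mB.eval N)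
    (Hm : ∀ᶠ N : ℕ in atTop, (P.mlen N (tStar f N) : ℝ) + 2 * N + 2 ≤ kL N * (P.kk N * tStar f N / 2 ^ bLen N - (P.kc N : ℝ) ^ 2)) :
    IsCompIndistinguishable (P.Dens f) (P.Eens f) := by
  intro A hA
  by_contra hns
  obtain ⟨c₀, hfreq⟩ := exists_frequently_ge_of_not_spd (fun n => distAdvantage_nonneg A _ _ n) hns
  have hgap : ∀ N, distAdvantage A (P.Dens f) (P.Eens f) N = |P.delta f A N (tStar f N) []| := fun N => by
    rw [distAdvantage, acceptPMF_Dens hlp, acceptPMF_Eens hlp, delta]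
  have hor : ∃ᶠ N : ℕ in atTop, 1 / (N : ℝ) ^ c₀ ≤ P.delta f A N (tStar f N) [] ∨ 1 / (N : ℝ) ^ c₀ ≤ P.delta f (flipAlg A) N (tStar f N) [] := by
    refine hfreq.mono fun N hN => ?_
    rw [hgap N] at hN
    rw [delta_flipAlg]
    rcases le_abs'.1 hN with h | h
    · exact Or.inr (by linarith)
    · exact Or.inl h
  rcases Filter.frequently_or_distrib.1 hor with h | h
  · exact not_frequently_gap hf hlp hS hkc hm Hm hA h
  · exact not_frequently_gap hf hlp hS hkc hm Hm (isPPT_flipAlg hA) h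

end Main

end Params

end GH

end HILL

end Literature.Computability.Cryptography
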